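import Literature.AlgebraicGeometry.Resolution.BirationalFlattening
import Literature.AlgebraicGeometry.Resolution.CommonAdmissibleBlowup
import Literature.AlgebraicGeometry.Resolution.IsoNearClosure
import Literature.AlgebraicGeometry.Resolution.GluingAfterBlowup
import Literature.AlgebraicGeometry.Morphisms.CompactificationExtension
import Literature.AlgebraicGeometry.Morphisms.CompactificationGluingPiece
import Literature.AlgebraicGeometry.Morphisms.TwoPieceImage
import Literature.AlgebraicGeometry.Morphisms.TwoPieceCompactification
import Literature.AlgebraicGeometry.Morphisms.CompactificationBaseGluing
import Literature.AlgebraicGeometry.Morphisms.NagataCompactificationOfFlattening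
import HarnessLib

/-!
# Nagata's compactification theorem: the proof (`NagataCompactification_holds`)

Topic: `Literature/AlgebraicGeometry/Morphisms`. Discharge of the named fact `NagataCompactification`
(`NagataCompactification.lean`; Conrad 2007, Thm. 4.1 = The Stacks Project, Tag 0F41): "Let `S` be a
quasi-compact and quasi-separated scheme. Let `X → S` be a separated, finite type morphism. Then
`X` has a compactification over `S`."

The tree already contained the whole proof of the Stacks Project (§38.33, Tags 0F3T–0F41) with
Raynaud–Gruson flattening (the named fact `Resolution.Stacks081R`, Stacks 081R) threaded through
as a hypothesis `(hRG : Stacks081R)`, entering only through Tag 081S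
(`stacks081S_of_stacks081R`): "a morphism which is an isomorphism over a quasi-compact open `U`
becomes an open immersion after a `U`-admissible blowing up". That tag is now proved
unconditionally (`Resolution.stacks081S`, file `Resolution/BirationalFlattening.lean`, by an
elementary two-level birational flattening after Conrad 2007, proof of Thm. 2.4, Cases 1–2), and
this file re-runs the chain without the hypothesis. Every theorem below is the UNCONDITIONAL
FORM of the theorem named in its docstring, with the same statement minus the binder
`(hRG : Stacks081R)` and the same proof (with `stacks081S` and the unconditional forms
substituted); all of them are declared in this file's path namespace
`Literature.AlgebraicGeometry.Morphisms` (also the twins of `Resolution.*` theorems):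

* `stacks081T`, `exists_isBlowup_dominating`, `exists_common_admissible_blowup` (file
  `Resolution/CommonAdmissibleBlowup.lean`:
  Stacks 081T; Conrad 2007, Thm. 2.11 and Remark 2.12: two compactifications have a common
  admissible blowing up);
* `stacks0F3W` (file `Resolution/IsoNearClosure.lean`: Stacks 0F3W);
* `stacks0F3X_side`, `stacks0F3X` (file `Resolution/GluingAfterBlowup.lean`: Stacks 0F3X);
* `stacks0F3Z` (file `CompactificationExtension.lean`: Stacks 0F3Z);
  `ExtData.nonempty_of_exists_compactification` (file `CompactificationGluingPiece.lean`);
* `ExtData.exists_isIso_near_closure`, `ExtData.exists_goodPair_of_extData` (file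
  `TwoPieceImage.lean`: Stacks 0F3W + 0F3Y in the proof of 0F40);
* `exists_compactification_of_twoPiece`, `stacks0F40` (file `TwoPieceCompactification.lean`:
  Stacks 0F40, the two-piece lemma, over a Noetherian base);
* `exists_compactification_of_sup_eq_top`, `exists_compactification_of_affineOpens` (file
  `CompactificationBaseGluing.lean`: compactifiability is Zariski-local on a quasi-compact
  quasi-separated base, which replaces the Noetherian approximation of general bases —
  Thomason–Trobaugh C.9 — of both printed proofs);
* `NagataCompactification_holds` (file `NagataCompactificationOfFlattening.lean`,
  `NagataCompactification.of_stacks081R`: over the affine opens of `S`, absolute Noetherian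
  approximation (Stacks 09ZP) reduces to the Noetherian induction of Tag 0F41 over a dense affine
  open cover, the affine pieces being compactified in `𝐏ⁿ` and the two-piece step being
  `stacks0F40`; the affine opens glue by `exists_compactification_of_affineOpens`).

## References

* B. Conrad, *Deligne's notes on Nagata compactifications*, J. Ramanujan Math. Soc. 22 (2007),
  Thm. 4.1, Thm. 2.4, Thm. 2.11, Remark 2.12. [Conrad2007]
* The Stacks Project, Tags 0F41, 0F40, 0F3Z, 0F3X, 0F3W, 081T, 081S, 09ZP. [StacksProject]
* M. Raynaud, L. Gruson, *Critères de platitude et de projectivité*, Invent. Math. 13 (1971),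
  Première partie, Thm. 5.2.2, 5.7.1. [RaynaudGruson1971]
-/

noncomputable section

-- Mathlib's pull-back API is stated through `abbrev`s over `limit`; as in Mathlib's own
-- algebraic-geometry files we let `simp`/unification see through them.
set_option backward.isDefEq.respectTransparency false

open CategoryTheory CategoryTheory.Limits AlgebraicGeometry TopologicalSpace

universe u

namespace Literature.AlgebraicGeometry.Morphisms

open Literature.AlgebraicGeometry.Resolution Literature.AlgebraicGeometry.Limits

/-! ## Consequences of Stacks 081S on admissible blowing ups: Tags 081T, 0F3W, 0F3X -/

/-! ### Stacks 081T -/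

/-- **Stacks, Tag 081T (for `φ` proper the strict transform of Tag 081S is an isomorphism).**
Let `S` be quasi-compact and quasi-separated, `φ : X → S` proper and `U ⊆ S` a quasi-compact
open over which `φ` is an isomorphism. Then for the `U`-admissible blowing up `b : S' → S` of
Tag 081S (in a centre `𝓘` of finite type with `V(𝓘) = S ∖ U`) the strict transform `X' → S'` is
an isomorphism: it is an open immersion (081S) and proper (a closed subscheme of `X ×_S S'`,
proper over `S'`), so its image is closed and open, and it contains the schematically dense
open `b⁻¹U = S' ∖ E` (over which `X' → S'` is an isomorphism); hence it is surjective.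
Unconditional form of `isIso_blowupStrictTransformMap_of_stacks081R` (same proof, with `stacks081S`
for `stacks081S_of_stacks081R`). [cite: StacksProject, Tag 081T] -/
theorem stacks081T {X S : Scheme.{u}}
    (φ : X ⟶ S) [CompactSpace S] [QuasiSeparatedSpace S] [IsProper φ] (U : S.Opens)
    (hU : IsCompact (U : Set S)) [IsIso (φ ∣_ U)] :
    ∃ (I : S.IdealSheafData) (S' : Scheme.{u}) (b : S' ⟶ S),
      (∀ W : S.affineOpens, (I.ideal W).FG) ∧ (I.support : Set S) = (U : Set S)ᶜ ∧
      IsBlowup b I ∧ IsIso (blowupStrictTransformMap φ b I) := by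
  obtain ⟨I, S', b, hfg, hsupp, hb, hopen⟩ := stacks081S φ U hU
  refine ⟨I, S', b, hfg, hsupp, hb, ?_⟩
  haveI := hopen
  -- `X' → S'` is proper
  haveI : IsProper (blowupStrictTransformMap φ b I) := by
    rw [← blowupStrictTransformι_snd]
    infer_instance
  -- its (closed, open) image contains the dense open `b⁻¹U = S' ∖ E`
  obtain rfl : U = centreCompl I := (centreCompl_eq_of_support_eq hsupp).symm
  haveI := isIso_blowupStrictTransformMap_morphismRestrict φ b I hb.isEffectiveCartier
  haveI hqc := hb.isEffectiveCartier.quasiCompact_ι_centreCompl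
  haveI hdom := hb.isEffectiveCartier.isSchemeTheoreticallyDominant_ι_centreCompl
  have hdense : Dense ((centreCompl (I.comap b) : S'.Opens) : Set S') := by
    rw [← Scheme.Opens.range_ι]
    exact (centreCompl (I.comap b)).ι.denseRange
  have hsub : ((centreCompl (I.comap b) : S'.Opens) : Set S') ⊆
      Set.range (blowupStrictTransformMap φ b I) := fun y hy => by
    rw [← preimage_centreCompl] at hy
    obtain ⟨x, hx⟩ := (Scheme.homeoOfIso (asIso ((blowupStrictTransformMap φ b I) ∣_
      (b ⁻¹ᵁ centreCompl I)))).surjective ⟨y, hy⟩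
    refine ⟨x.1, ?_⟩
    have := congrArg Subtype.val hx
    simpa only [Scheme.homeoOfIso_apply, asIso_hom, morphismRestrict_base_coe] using this
  have hclosed : IsClosed (Set.range (blowupStrictTransformMap φ b I)) :=
    (blowupStrictTransformMap φ b I).isClosedMap.isClosed_range
  haveI : Surjective (blowupStrictTransformMap φ b I) := ⟨by
    rw [← Set.range_eq_univ, ← hclosed.closure_eq]
    exact (hdense.mono hsub).closure_eq⟩
  exact (isIso_iff_isOpenImmersion_and_epi_base (f := blowupStrictTransformMap φ b I)).mpr
    ⟨inferInstance, (TopCat.epi_iff_surjective _).mpr (blowupStrictTransformMap φ b I).surjective⟩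


/-- **Stacks 081T with Tag 080E: a proper modification is dominated by a common admissible
blowing up.** In the situation of `stacks081T` there is,
besides the `U`-admissible blowing up `b : S' → S` in `𝓘`, a morphism `r : S' → X` with
`r ≫ φ = b` which is the blowing up of `X` in `φ⁻¹𝓘 𝒪_X` (namely the inverse of the strict
transform isomorphism followed by `X' ⊆ X ×_S S' → X`, a blowing up in `φ⁻¹𝓘 𝒪_X` by Tag 080E).
Unconditional form of `exists_isBlowup_dominating_of_stacks081R`.
[cite: StacksProject, Tag 081T; Conrad2007, Thm. 2.11] -/
theorem exists_isBlowup_dominating {X S : Scheme.{u}}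
    (φ : X ⟶ S) [CompactSpace S] [QuasiSeparatedSpace S] [IsProper φ] (U : S.Opens)
    (hU : IsCompact (U : Set S)) [IsIso (φ ∣_ U)] :
    ∃ (I : S.IdealSheafData) (S' : Scheme.{u}) (b : S' ⟶ S) (r : S' ⟶ X),
      (∀ W : S.affineOpens, (I.ideal W).FG) ∧ (I.support : Set S) = (U : Set S)ᶜ ∧
      IsBlowup b I ∧ r ≫ φ = b ∧ IsBlowup r (I.comap φ) := by
  obtain ⟨I, S', b, hfg, hsupp, hb, hiso⟩ :=
    stacks081T φ U hU
  haveI := hiso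
  refine ⟨I, S', b, inv (blowupStrictTransformMap φ b I) ≫ blowupStrictTransformι φ b I ≫
    pullback.fst φ b, hfg, hsupp, hb, ?_, ?_⟩
  · rw [Category.assoc, Category.assoc, pullback.condition, ← Category.assoc _ _ b,
      blowupStrictTransformι_snd, IsIso.inv_hom_id_assoc]
  · exact (isBlowup_blowupStrictTransform φ b I hb).iso_comp
      (asIso (blowupStrictTransformMap φ b I)).symm


/-! ### Two compactifications have a common admissible blowing up -/

/-- **Two compactifications of a quasi-compact scheme have a common admissible blowing up**
(Conrad 2007, Remark 2.12 and the special case of Cor. 2.10 before Thm. 2.11; here from Stacks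
081T twice and 080L once, see the module docstring). For open immersions `eᵢ : V → Yᵢ` into
proper `B`-schemes `qᵢ : Yᵢ → B`, `B` quasi-compact and quasi-separated, `V` quasi-compact,
with `e₁ ≫ q₁ = e₂ ≫ q₂`: there are `T`, an open immersion `e : V → T` and `tᵢ : T → Yᵢ` with
`e ≫ tᵢ = eᵢ` and `t₁ ≫ q₁ = t₂ ≫ q₂`, where `tᵢ` is the blowing up of `Yᵢ` in an ideal sheaf
`𝓚ᵢ` of finite type whose support does not meet `eᵢ(V)`. Unconditional form of
`exists_common_admissible_blowup_of_stacks081R` (same proof).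
[cite: Conrad2007, Remark 2.12; StacksProject, Tag 081T] -/
theorem exists_common_admissible_blowup
    {V Y₁ Y₂ B : Scheme.{u}} [CompactSpace B] [QuasiSeparatedSpace B] [CompactSpace V]
    (e₁ : V ⟶ Y₁) (q₁ : Y₁ ⟶ B) (e₂ : V ⟶ Y₂) (q₂ : Y₂ ⟶ B)
    [IsOpenImmersion e₁] [IsOpenImmersion e₂] [IsProper q₁] [IsProper q₂]
    (h : e₁ ≫ q₁ = e₂ ≫ q₂) :
    ∃ (T : Scheme.{u}) (e : V ⟶ T) (t₁ : T ⟶ Y₁) (t₂ : T ⟶ Y₂)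
      (K₁ : Y₁.IdealSheafData) (K₂ : Y₂.IdealSheafData),
      IsOpenImmersion e ∧ e ≫ t₁ = e₁ ∧ e ≫ t₂ = e₂ ∧ t₁ ≫ q₁ = t₂ ≫ q₂ ∧
      (∀ W : Y₁.affineOpens, (K₁.ideal W).FG) ∧
      Disjoint (e₁.opensRange : Set Y₁) (K₁.support : Set Y₁) ∧ IsBlowup t₁ K₁ ∧
      (∀ W : Y₂.affineOpens, (K₂.ideal W).FG) ∧
      Disjoint (e₂.opensRange : Set Y₂) (K₂.support : Set Y₂) ∧ IsBlowup t₂ K₂ := by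
  -- `Y₁`, `Y₂` are quasi-compact and quasi-separated
  haveI : CompactSpace Y₁ := QuasiCompact.compactSpace_of_compactSpace q₁
  haveI : CompactSpace Y₂ := QuasiCompact.compactSpace_of_compactSpace q₂
  haveI : QuasiSeparatedSpace Y₁ := quasiSeparatedSpace_of_quasiSeparated q₁
  haveI : QuasiSeparatedSpace Y₂ := quasiSeparatedSpace_of_quasiSeparated q₂
  /- (1) the scheme-theoretic image `Z` of `(e₁, e₂) : V → Y₁ ×_B Y₂`; its projections `pᵢ` are
  proper and isomorphisms over `eᵢ(V)` -/
  set m : V ⟶ pullback q₁ q₂ := pullback.lift e₁ e₂ h with hm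
  have hm₁ : m ≫ pullback.fst q₁ q₂ = e₁ := pullback.lift_fst _ _ _
  have hm₂ : m ≫ pullback.snd q₁ q₂ = e₂ := pullback.lift_snd _ _ _
  haveI : QuasiSeparatedSpace ↑(pullback q₁ q₂) :=
    quasiSeparatedSpace_of_quasiSeparated (pullback.fst q₁ q₂ ≫ q₁)
  set p₁ : m.image ⟶ Y₁ := m.imageι ≫ pullback.fst q₁ q₂ with hp₁
  set p₂ : m.image ⟶ Y₂ := m.imageι ≫ pullback.snd q₁ q₂ with hp₂
  have hp₁₂ : p₁ ≫ q₁ = p₂ ≫ q₂ := by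
    rw [hp₁, hp₂, Category.assoc, Category.assoc, pullback.condition]
  have htp₁ : m.toImage ≫ p₁ = e₁ := by rw [hp₁, Scheme.Hom.toImage_imageι_assoc, hm₁]
  have htp₂ : m.toImage ≫ p₂ = e₂ := by rw [hp₂, Scheme.Hom.toImage_imageι_assoc, hm₂]
  haveI hiso₁ : IsIso (p₁ ∣_ e₁.opensRange) :=
    GraphClosure.isIso_morphismRestrict e₁ (pullback.fst q₁ q₂) m hm₁
  haveI hiso₂ : IsIso (p₂ ∣_ e₂.opensRange) :=
    GraphClosure.isIso_morphismRestrict e₂ (pullback.snd q₁ q₂) m hm₂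
  obtain ⟨-, hrange₁⟩ :=
    GraphClosure.isOpenImmersion_toImage_and_range e₁ (pullback.fst q₁ q₂) m hm₁
  obtain ⟨-, hrange₂⟩ :=
    GraphClosure.isOpenImmersion_toImage_and_range e₂ (pullback.snd q₁ q₂) m hm₂
  haveI : IsProper p₁ := by rw [hp₁]; infer_instance
  haveI : IsProper p₂ := by rw [hp₂]; infer_instance
  haveI : CompactSpace ↑m.image := QuasiCompact.compactSpace_of_compactSpace p₁
  haveI : QuasiSeparatedSpace ↑m.image := quasiSeparatedSpace_of_quasiSeparated p₁
  have hU₁ : IsCompact (e₁.opensRange : Set Y₁) := isCompact_range e₁.continuous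
  have hU₂ : IsCompact (e₂.opensRange : Set Y₂) := isCompact_range e₂.continuous
  -- `p₂⁻¹(e₂ V) ⊆ p₁⁻¹(e₁ V)` (both are `V ⊆ Z`)
  have hle : ∀ z : ↑m.image, p₂ z ∈ e₂.opensRange → p₁ z ∈ e₁.opensRange := by
    intro z hz
    have hz' : z ∈ Set.range m.toImage := by
      rw [hrange₂]
      exact hz
    obtain ⟨x, rfl⟩ := hz'
    exact ⟨x, by rw [← Scheme.Hom.comp_apply, htp₁]⟩
  /- (2) Stacks 081T for `p₁`: an `e₁(V)`-admissible blowing up `b₁ : T₁ → Y₁` dominating `Z`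
  through the blowing up `r₁ : T₁ → Z` in the pulled-back centre -/
  obtain ⟨I₁, T₁, b₁, r₁, hI₁fg, hI₁supp, hb₁, hr₁p, hr₁⟩ :=
    exists_isBlowup_dominating p₁ e₁.opensRange hU₁
  haveI : IsProper b₁ := IsBlowup.isProper_of_fg hI₁fg hb₁
  haveI : IsProper r₁ := IsBlowup.isProper_of_fg (fg_ideal_comap p₁ hI₁fg) hr₁
  haveI : CompactSpace T₁ := QuasiCompact.compactSpace_of_compactSpace b₁
  haveI : QuasiSeparatedSpace T₁ := quasiSeparatedSpace_of_quasiSeparated b₁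
  -- the proper `w = r₁ ≫ p₂ : T₁ → Y₂` is an isomorphism over `e₂(V)`
  haveI : IsIso (r₁ ∣_ (p₂ ⁻¹ᵁ e₂.opensRange)) := by
    refine hr₁.isIso_morphismRestrict ?_
    rw [Scheme.IdealSheafData.support_comap]
    refine Set.disjoint_left.mpr fun z hz hzI => ?_
    have hzI' : p₁ z ∈ (I₁.support : Set Y₁) := hzI
    rw [hI₁supp] at hzI'
    exact hzI' (hle z hz)
  haveI : IsIso ((r₁ ≫ p₂) ∣_ e₂.opensRange) := isIso_morphismRestrict_comp r₁ p₂ e₂.opensRange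
  /- (3) Stacks 081T for `w`: an `e₂(V)`-admissible blowing up `b₂ : T → Y₂` dominating `T₁`
  through the blowing up `r₂ : T → T₁` in the pulled-back centre -/
  obtain ⟨I₂, T, b₂, r₂, hI₂fg, hI₂supp, hb₂, hr₂w, hr₂⟩ :=
    exists_isBlowup_dominating (r₁ ≫ p₂) e₂.opensRange hU₂
  /- (4) `t₁ = r₂ ≫ b₁` is an `e₁(V)`-admissible blowing up (Stacks 080L) -/
  have hdisj₁ : Disjoint (e₁.opensRange : Set Y₁) (I₁.support : Set Y₁) := by
    rw [hI₁supp]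
    exact disjoint_compl_right
  have hdisj₂ : Disjoint (e₂.opensRange : Set Y₂) (I₂.support : Set Y₂) := by
    rw [hI₂supp]
    exact disjoint_compl_right
  have hdisj₂' : Disjoint ((b₁ ⁻¹ᵁ e₁.opensRange : T₁.Opens) : Set T₁)
      ((I₂.comap (r₁ ≫ p₂)).support : Set T₁) := by
    rw [Scheme.IdealSheafData.support_comap]
    refine Set.disjoint_left.mpr fun t ht htI => ?_
    have htI' : (r₁ ≫ p₂) t ∈ (I₂.support : Set Y₂) := htI
    rw [hI₂supp] at htI'
    apply htI'
    -- `b₁ t ∈ e₁(V)` forces `r₁ t ∈ V ⊆ Z`, whence `p₂ (r₁ t) ∈ e₂(V)`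
    have h1 : p₁ (r₁ t) ∈ e₁.opensRange := by
      rw [← Scheme.Hom.comp_apply, hr₁p]
      exact ht
    have h2 : r₁ t ∈ Set.range m.toImage := by
      rw [hrange₁]
      exact h1
    obtain ⟨x, hx⟩ := h2
    refine ⟨x, ?_⟩
    rw [Scheme.Hom.comp_apply, ← hx, ← Scheme.Hom.comp_apply, htp₂]
  obtain ⟨K₁, hK₁fg, hK₁disj, hK₁⟩ := hb₁.exists_isBlowup_comp_admissible e₁.opensRange hI₁fg
    hdisj₁ hr₂ (fg_ideal_comap (r₁ ≫ p₂) hI₂fg) hdisj₂'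
  /- (5) the open immersion `e : V → T`: lift `e₂` through `b₂`, an isomorphism over `e₂(V)` -/
  haveI : IsIso (b₂ ∣_ e₂.opensRange) := hb₂.isIso_morphismRestrict hdisj₂
  obtain ⟨e, he₂, hoe⟩ : ∃ e : V ⟶ T, e ≫ b₂ = e₂ ∧ IsOpenImmersion e :=
    ⟨e₂.isoOpensRange.hom ≫ inv (b₂ ∣_ e₂.opensRange) ≫ (b₂ ⁻¹ᵁ e₂.opensRange).ι, by
      rw [Category.assoc, Category.assoc, ← morphismRestrict_ι, IsIso.inv_hom_id_assoc,
        Scheme.Hom.isoOpensRange_hom_ι], inferInstance⟩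
  -- `e ≫ r₂ ≫ r₁` is the corestriction `V → Z` (both agree after `p₂`, over `e₂(V)`)
  have hcomp : (e ≫ r₂ ≫ r₁) ≫ p₂ = m.toImage ≫ p₂ := by
    simp only [Category.assoc]
    rw [hr₂w, he₂, htp₂]
  have key : e ≫ r₂ ≫ r₁ = m.toImage := by
    refine eq_of_comp_eq_of_isIso_morphismRestrict p₂ e₂.opensRange hcomp fun x => ?_
    rw [← Scheme.Hom.comp_apply, hcomp, htp₂]
    exact ⟨x, rfl⟩
  refine ⟨T, e, r₂ ≫ b₁, b₂, K₁, I₂, hoe, ?_, he₂, ?_, hK₁fg, hK₁disj, hK₁, hI₂fg,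
    hdisj₂, hb₂⟩
  · -- `e ≫ r₂ ≫ b₁ = e ≫ r₂ ≫ r₁ ≫ p₁ = V → Z → Y₁ = e₁`
    rw [← hr₁p, ← htp₁, ← key]
    simp only [Category.assoc]
  · -- `(r₂ ≫ b₁) ≫ q₁ = r₂ ≫ r₁ ≫ p₁ ≫ q₁ = r₂ ≫ r₁ ≫ p₂ ≫ q₂ = b₂ ≫ q₂`
    rw [Category.assoc, ← hr₁p, Category.assoc, hp₁₂, ← hr₂w]
    simp only [Category.assoc]


/-! ### Stacks 0F3W -/

/-- **Stacks 0F3W.** Let `f : X → Y` be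
proper with `Y` quasi-compact and quasi-separated, `V ⊆ Y` a quasi-compact open, `T ⊆ V` closed in
`V`, and `N ⊆ V` an open neighbourhood of `T` over which `f` is an isomorphism. Then there are a
`V`-admissible blowing up `b : Y' → Y` — the blowing up in an ideal sheaf `𝓠` of finite type with
`V(𝓠) = Y ∖ V` — and an open `N' ⊆ Y'` containing the closure of `b⁻¹(T)` over which the strict
transform `X' → Y'` of `f` (Stacks 080D, w.r.t. `V(𝓠)`) is an isomorphism. Unconditional form of
`stacks0F3W_of_stacks081R` (same proof, with `stacks081S`). [cite: StacksProject, Tag 0F3W] -/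
theorem stacks0F3W {X Y : Scheme.{u}} [CompactSpace Y] [QuasiSeparatedSpace Y] (f : X ⟶ Y) [IsProper f]
    (V : Y.Opens) (hV : IsCompact (V : Set Y)) (T : Set Y) (hTV : T ⊆ V)
    (hTcl : closure T ∩ (V : Set Y) ⊆ T) (N : Y.Opens) (hNV : N ≤ V) (hTN : T ⊆ N) [IsIso (f ∣_ N)] :
    ∃ (Q : Y.IdealSheafData) (Y' : Scheme.{u}) (b : Y' ⟶ Y) (N' : Y'.Opens),
      (∀ W : Y.affineOpens, (Q.ideal W).FG) ∧ (Q.support : Set Y) = (V : Set Y)ᶜ ∧ IsBlowup b Q ∧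
      closure (b ⁻¹' T) ⊆ N' ∧ IsIso (blowupStrictTransformMap f b Q ∣_ N') := by
  /- Step 0: a first normalised blowing up `bv : Yv → Y` (centre supported on exactly `Y ∖ V`) -/
  obtain ⟨Qv, Yv, bv, hQvfg, hQvsupp, hbv, hbvp⟩ := exists_isBlowup_normalised V hV
  haveI := hbvp
  haveI : CompactSpace Yv := QuasiCompact.compactSpace_of_compactSpace bv
  haveI : QuasiSeparatedSpace Yv := quasiSeparatedSpace_of_quasiSeparated bv
  set Vv : Yv.Opens := bv ⁻¹ᵁ V with hVv
  set Nv : Yv.Opens := bv ⁻¹ᵁ N with hNv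
  set Tv : Set Yv := bv ⁻¹' T with hTv
  have hVvc : IsCompact (Vv : Set Yv) := bv.isCompact_preimage hV
  have hTVv : Tv ⊆ Vv := fun x hx => hTV hx
  have hTNv : Tv ⊆ Nv := fun x hx => hTN hx
  have hNVv : Nv ≤ Vv := fun x hx => hNV hx
  have hTvcl : closure Tv ∩ (Vv : Set Yv) ⊆ Tv := by
    rintro x ⟨hx, hxV⟩
    have h1 : bv x ∈ closure T :=
      (closure_minimal (Set.preimage_mono subset_closure) (isClosed_closure.preimage bv.continuous)) hx
    exact hTcl ⟨h1, hxV⟩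
  /- Step 1: constructible closed `T₁ ⊇ Tv`, `T₂ ⊇ Vv ∖ Nv` in `Vv`, disjoint; namely
    `T₁ = Vv ∖ W`, `T₂ = Vv ∖ W'` for quasi-compact opens `W ⊇ Vv ∖ Nv` missing `Tv` and
    `W' ⊇ Vv ∖ W` inside `Nv` -/
  obtain ⟨W, hWc, hW₁, hW₂⟩ := exists_isCompact_isOpen_superset (X := Yv) (K := (Vv : Set Yv) \ Nv)
    (O := (Vv : Set Yv) \ closure Tv) (hVvc.diff Nv.2) (Vv.2.sdiff isClosed_closure) (by
      rintro x ⟨hxV, hxN⟩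
      exact ⟨hxV, fun hx => hxN (hTNv (hTvcl ⟨hx, hxV⟩))⟩)
  have hWV : (W : Set Yv) ⊆ Vv := fun x hx => (hW₂ hx).1
  have hWT : Disjoint (W : Set Yv) Tv := Set.disjoint_left.mpr fun x hx hxT => (hW₂ hx).2 (subset_closure hxT)
  obtain ⟨W', hW'c, hW'₁, hW'₂⟩ := exists_isCompact_isOpen_superset (X := Yv) (K := (Vv : Set Yv) \ W)
    (O := (Nv : Set Yv)) (hVvc.diff W.2) Nv.2 (by
      rintro x ⟨hxV, hxW⟩
      by_contra hxN
      exact hxW (hW₁ ⟨hxV, hxN⟩))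
  have hW'V : (W' : Set Yv) ⊆ Vv := fun x hx => hNVv (hW'₂ hx)
  set T₁ : Set Yv := (Vv : Set Yv) \ W with hT₁
  set T₂ : Set Yv := (Vv : Set Yv) \ W' with hT₂
  have hTvT₁ : Tv ⊆ T₁ := fun x hx => ⟨hTVv hx, fun hxW => Set.disjoint_left.mp hWT hxW hx⟩
  have hT₁₂ : Disjoint T₁ T₂ := Set.disjoint_left.mpr fun x hx₁ hx₂ => hx₂.2 (hW'₁ hx₁)
  /- Step 2 (0F3V): a `Vv`-admissible blowing up `b₁ : Y₁ → Yv` separating the closures of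
    `T₁` and `T₂`; normalise the tower -/
  obtain ⟨C₁, Y₁, b₁, hC₁fg, hC₁V, hb₁, hsep⟩ := stacks0F3V (X := Yv) Vv T₁ T₂ Set.sdiff_subset
    Set.sdiff_subset (by rw [hT₁, Set.sdiff_sdiff_cancel_left hWV]; exact W.2)
    (by rw [hT₂, Set.sdiff_sdiff_cancel_left hW'V]; exact W'.2)
    (by rw [hT₁, Set.sdiff_sdiff_cancel_left hWV]; exact hWc)
    (by rw [hT₂, Set.sdiff_sdiff_cancel_left hW'V]; exact hW'c) hT₁₂
  obtain ⟨hb₁', hC₁'fg, hC₁'supp, Q₁, hQ₁fg, hQ₁supp, hbQ₁⟩ :=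
    hbv.normalised_comp hQvfg hQvsupp hb₁ hC₁fg hC₁V
  haveI : IsProper b₁ := IsBlowup.isProper_of_fg hC₁fg hb₁
  haveI : CompactSpace Y₁ := QuasiCompact.compactSpace_of_compactSpace b₁
  haveI : QuasiSeparatedSpace Y₁ := quasiSeparatedSpace_of_quasiSeparated b₁
  set b₀₁ : Y₁ ⟶ Y := b₁ ≫ bv with hb₀₁
  have hEQ₁ : IsEffectiveCartier (Q₁.comap b₀₁) := hbQ₁.isEffectiveCartier
  have hccQ₁ : centreCompl Q₁ = V := centreCompl_eq_of_support_eq hQ₁supp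
  -- the strict transform `f₁ : X₁ → Y₁` of `f` along `b₀₁`, an isomorphism over `N₁ = b₁⁻¹W'`
  set f₁ := blowupStrictTransformMap f b₀₁ Q₁ with hf₁
  set V₁ : Y₁.Opens := b₀₁ ⁻¹ᵁ V with hV₁
  set N₁ : Y₁.Opens := b₁ ⁻¹ᵁ W' with hN₁
  have hV₁c : IsCompact (V₁ : Set Y₁) := b₀₁.isCompact_preimage hV
  have hN₁le : N₁ ≤ b₀₁ ⁻¹ᵁ N := fun x hx => hW'₂ hx
  haveI : IsIso (f₁ ∣_ b₀₁ ⁻¹ᵁ N) :=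
    isIso_blowupStrictTransformMap_morphismRestrict_of_le f b₀₁ Q₁ hEQ₁ (hccQ₁ ▸ hNV)
  haveI : IsIso (f₁ ∣_ N₁) := Morphisms.isIso_morphismRestrict_of_le f₁ hN₁le
  -- the disjoint closed sets `A ⊇ closure (b₀₁⁻¹ T)` and `B`
  set A : Set Y₁ := closure (b₁ ⁻¹' T₁) with hA
  set B : Set Y₁ := closure (b₁ ⁻¹' T₂) with hB
  /- Step 3: a quasi-compact open `Y₀ ⊇ A` missing `B`; over `V₁ ∩ Y₀ ⊆ N₁`, `f₁` is an isomorphism -/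
  obtain ⟨Y₀, hY₀c, hAY₀, hY₀B⟩ := exists_isCompact_isOpen_separating (X := Y₁) isClosed_closure
    isClosed_closure hsep
  have hVY₀ : V₁ ⊓ Y₀ ≤ N₁ := by
    rintro x ⟨hxV, hxY⟩
    have hx2 : b₁ x ∉ T₂ := fun h => Set.disjoint_left.mp hY₀B hxY (subset_closure h)
    by_contra hxN
    exact hx2 ⟨hxV, hxN⟩
  haveI : IsIso (f₁ ∣_ (V₁ ⊓ Y₀)) := Morphisms.isIso_morphismRestrict_of_le f₁ hVY₀
  /- Step 4 (081S over `Y₀`): the strict transform of `φ = f₁ ×_{Y₁} Y₀ → Y₀` along a normalised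
    `O₀`-admissible blowing up `by₀ : Y₀' → Y₀` (`O₀ = V₁ ∩ Y₀`) is an open immersion, hence an
    isomorphism (it is proper with dense image) -/
  haveI : CompactSpace (Y₀ : Scheme.{u}) := isCompact_iff_compactSpace.mp hY₀c
  haveI : QuasiSeparatedSpace (Y₀ : Scheme.{u}) := quasiSeparatedSpace_of_quasiSeparated Y₀.ι
  set φ := pullback.snd f₁ Y₀.ι with hφ
  set O₀ : (Y₀ : Scheme.{u}).Opens := Y₀.ι ⁻¹ᵁ V₁ with hO₀
  have hO₀' : Y₀.ι ⁻¹ᵁ (V₁ ⊓ Y₀) = O₀ := by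
    ext x
    exact ⟨fun h => h.1, fun h => ⟨h, x.2⟩⟩
  have hO₀c : IsCompact (O₀ : Set (Y₀ : Scheme.{u})) := by
    rw [Y₀.ι.isOpenEmbedding.isInducing.isCompact_iff]
    have e : (Y₀.ι.base) '' (O₀ : Set (Y₀ : Scheme.{u})) = (V₁ : Set Y₁) ∩ Y₀ := by
      rw [show (O₀ : Set (Y₀ : Scheme.{u})) = Y₀.ι.base ⁻¹' (V₁ : Set Y₁) from rfl,
        Set.image_preimage_eq_inter_range, Scheme.Opens.range_ι]
    rw [e]
    exact QuasiSeparatedSpace.inter_isCompact _ _ V₁.2 hV₁c Y₀.2 hY₀c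
  haveI : IsIso (φ ∣_ O₀) := by
    have h := isIso_morphismRestrict_pullback_snd f₁ Y₀.ι (V₁ ⊓ Y₀)
    rw [hO₀'] at h
    exact h
  obtain ⟨Qy, Y₀', by₀, hQyfg, hQysupp, hby₀, hopen⟩ := stacks081S φ O₀ hO₀c
  have hccQy : centreCompl Qy = O₀ := centreCompl_eq_of_support_eq hQysupp
  haveI := hopen
  set ψ₀ := blowupStrictTransformMap φ by₀ Qy with hψ₀
  haveI : IsIso ψ₀ := by
    obtain ⟨hqc, hsd⟩ := hby₀.quasiCompact_and_isSchemeTheoreticallyDominant_ι_preimage hQysupp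
    haveI := hqc
    haveI := hsd
    have hD : Dense (((by₀ ⁻¹ᵁ O₀ : Y₀'.Opens)) : Set Y₀') := by
      rw [← Scheme.Opens.range_ι]
      exact (by₀ ⁻¹ᵁ O₀).ι.denseRange
    refine isIso_of_isOpenImmersion_of_universallyClosed_of_dense ψ₀ hD ?_
    intro y hy
    -- `by₀ y ∈ O₀` is hit by `φ` (an isomorphism over `O₀`), so `y` lifts to `φ ×_{Y₀} Y₀'`, in
    -- the open over `by₀⁻¹(Y₀ ∖ V(𝓠y))`, hence to the strict transform
    have hy' : by₀ y ∈ Set.range φ := by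
      obtain ⟨x, hx⟩ := (ConcreteCategory.bijective_of_isIso (φ ∣_ O₀).base).2 ⟨by₀ y, hy⟩
      exact ⟨x.1, by rw [← morphismRestrict_base_coe φ O₀ x, hx]⟩
    obtain ⟨z, hz⟩ : y ∈ Set.range (pullback.snd φ by₀) := by rw [Scheme.Pullback.range_snd]; exact hy'
    have hzO : z ∈ ((pullback.snd φ by₀) ⁻¹ᵁ (by₀ ⁻¹ᵁ centreCompl Qy) : (pullback φ by₀).Opens) := by
      show by₀ (pullback.snd φ by₀ z) ∈ centreCompl Qy
      rw [hz, hccQy]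
      exact hy
    obtain ⟨z'', hz''⟩ := mem_range_imageι_of_mem _ hzO
    refine ⟨z'', ?_⟩
    show (blowupStrictTransformι φ by₀ Qy ≫ pullback.snd φ by₀) z'' = y
    rw [Scheme.Hom.comp_apply]
    erw [hz'']
    exact hz
  /- Step 5 (080M): extend the centre `𝓠y` from `Y₀` to a `V₁`-admissible centre `G` on `Y₁`,
    blow up and normalise: `b₂ : Y₂ → Y₁`, total `b = b₂ ≫ b₀₁`, centre `𝓠₂` with `V(𝓠₂) = Y ∖ V` -/
  obtain ⟨G, hGfg, hGcomap, hGV⟩ := exists_fg_comap_ι_eq_of_disjoint V₁ hV₁c Y₀ hY₀c Qy hQyfg (by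
    rw [hQysupp]; exact disjoint_compl_right)
  obtain ⟨Y₂, b₂, hb₂⟩ := exists_isBlowup Y₁ G
  obtain ⟨hb₂', hG'fg, hG'supp, Q₂, hQ₂fg, hQ₂supp, hbQ₂⟩ :=
    hbQ₁.normalised_comp hQ₁fg hQ₁supp hb₂ hGfg hGV
  haveI : IsProper b₂ := IsBlowup.isProper_of_fg hGfg hb₂
  set G' := G * Q₁.comap b₀₁ with hG'
  have hEG' : IsEffectiveCartier (G'.comap b₂) := hb₂'.isEffectiveCartier
  set b : Y₂ ⟶ Y := b₂ ≫ b₀₁ with hb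
  have hEQ₂ : IsEffectiveCartier (Q₂.comap b) := hbQ₂.isEffectiveCartier
  refine ⟨Q₂, Y₂, b, b₂ ⁻¹ᵁ Y₀, hQ₂fg, hQ₂supp, hbQ₂, ?_, ?_⟩
  · /- the closure of `b⁻¹(T)` lies in `b₂⁻¹(A) ⊆ b₂⁻¹(Y₀)` -/
    have h1 : b ⁻¹' T ⊆ b₂ ⁻¹' A := by
      intro x hx
      have hx' : b₁ (b₂ x) ∈ T₁ := hTvT₁ (show bv (b₁ (b₂ x)) ∈ T by
        rw [← Scheme.Hom.comp_apply, ← Scheme.Hom.comp_apply]; exact hx)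
      exact subset_closure hx'
    exact (closure_minimal h1 (isClosed_closure.preimage b₂.continuous)).trans
      (Set.preimage_mono hAY₀)
  · /- `f'` is an isomorphism over `b₂⁻¹(Y₀)`: transport `IsIso ψ₀` along the identifications -/
    -- (a) `by₂ : Y₂ ×_{Y₁} Y₀ → Y₀` is, like `by₀`, a blowing up of `Y₀` in `𝓠y · L`
    set by₂ := pullback.snd b₂ Y₀.ι with hby₂
    set j := pullback.fst b₂ Y₀.ι with hj
    set L := (Q₁.comap b₀₁).comap Y₀.ι with hL
    have hLc : IsEffectiveCartier L := hEQ₁.comap_of_isOpenImmersion Y₀.ι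
    have hG'Y₀ : G'.comap Y₀.ι = Qy * L := by rw [hG', comap_mul, hGcomap]
    have hby₂' : IsBlowup by₂ (Qy * L) := by
      rw [← hG'Y₀, hby₂, ← pullbackRestrictIsoRestrict_hom_morphismRestrict]
      exact (hb₂'.restrict Y₀).iso_comp (pullbackRestrictIsoRestrict b₂ Y₀)
    have hby₀' : IsBlowup by₀ (Qy * L) := hby₀.mul_of_isEffectiveCartier hLc
    obtain ⟨e, he, -⟩ := hby₀'.unique hby₂'
    have hEy₂ : IsEffectiveCartier (Qy.comap by₂) := by
      have h := hby₂'.isEffectiveCartier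
      rw [comap_mul] at h
      exact h.of_mul_left
    haveI : QuasiCompact ((pullback.snd φ by₂) ⁻¹ᵁ (by₂ ⁻¹ᵁ centreCompl Qy)).ι := by
      rw [preimage_centreCompl]
      exact quasiCompact_ι_preimage_centreCompl _ hEy₂
    have step_a : IsIso (blowupStrictTransformMap φ by₂ Qy) :=
      (MorphismProperty.isomorphisms.iff _).mp
        ((blowupStrictTransformMap_iff_of_iso_base φ Qy (MorphismProperty.isomorphisms Scheme.{u})
          by₀ by₂ e he).mpr ((MorphismProperty.isomorphisms.iff _).mpr inferInstance))
    -- (b) target locality: the strict transform of `f₁` along `j ≫ b₂` is an isomorphism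
    have hLsupp : (L.support : Set (Y₀ : Scheme.{u})) = (O₀ : Set (Y₀ : Scheme.{u}))ᶜ := by
      rw [hL, Scheme.IdealSheafData.support_comap, Scheme.IdealSheafData.support_comap]
      ext x
      change b₀₁ (Y₀.ι x) ∈ (Q₁.support : Set Y) ↔ ¬ (Y₀.ι x ∈ (V₁ : Set Y₁))
      rw [hQ₁supp, Set.mem_compl_iff]
      rfl
    have hcc : centreCompl Qy = centreCompl (G'.comap Y₀.ι) := by
      rw [hG'Y₀, hccQy]
      refine (centreCompl_eq_of_support_eq ?_).symm
      rw [Scheme.IdealSheafData.support_mul, TopologicalSpace.Closeds.coe_sup, hQysupp, hLsupp,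
        Set.union_self]
    have step_b : IsIso (blowupStrictTransformMap f₁ (j ≫ b₂) G') := by
      have h1 := (blowupStrictTransformMap_congr_centre φ by₂ (MorphismProperty.isomorphisms Scheme.{u})
        hcc).mp ((MorphismProperty.isomorphisms.iff _).mpr step_a)
      exact (MorphismProperty.isomorphisms.iff _).mp
        ((blowupStrictTransformMap_baseChange_iff f₁ b₂ G' Y₀.ι (MorphismProperty.isomorphisms Scheme.{u})
          hEG').mp h1)
    -- (c) the tower: the strict transform of `f` along `(j ≫ b₂) ≫ b₀₁` is an isomorphism
    have hEJ : IsEffectiveCartier (G'.comap (j ≫ b₂)) := by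
      rw [Scheme.IdealSheafData.comap_comp]
      exact hEG'.comap_of_isOpenImmersion j
    have hE₂ : IsEffectiveCartier (Q₂.comap ((j ≫ b₂) ≫ b₀₁)) := by
      rw [Category.assoc, Scheme.IdealSheafData.comap_comp]
      exact hEQ₂.comap_of_isOpenImmersion j
    have step_c : IsIso (blowupStrictTransformMap f ((j ≫ b₂) ≫ b₀₁) Q₂) :=
      (MorphismProperty.isomorphisms.iff _).mp
        ((blowupStrictTransformMap_tower_iff f V (MorphismProperty.isomorphisms Scheme.{u}) hQ₁supp hEQ₁
          (j ≫ b₂) G' hG'supp hEJ Q₂ hQ₂supp hE₂).mp ((MorphismProperty.isomorphisms.iff _).mpr step_b))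
    -- (d) reassociate and restrict over `j(Y₂ ×_{Y₁} Y₀) = b₂⁻¹(Y₀)`
    have hEjb : IsEffectiveCartier (Q₂.comap (j ≫ b)) := by
      rw [Scheme.IdealSheafData.comap_comp]
      exact hEQ₂.comap_of_isOpenImmersion j
    haveI : QuasiCompact ((pullback.snd f (j ≫ b)) ⁻¹ᵁ ((j ≫ b) ⁻¹ᵁ centreCompl Q₂)).ι := by
      rw [preimage_centreCompl]
      exact quasiCompact_ι_preimage_centreCompl _ hEjb
    have step_d : IsIso (blowupStrictTransformMap f (j ≫ b) Q₂) :=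
      (MorphismProperty.isomorphisms.iff _).mp
        ((blowupStrictTransformMap_iff_of_iso_base f Q₂ (MorphismProperty.isomorphisms Scheme.{u})
          ((j ≫ b₂) ≫ b₀₁) (j ≫ b) (Iso.refl _) (by rw [Iso.refl_hom, Category.id_comp, hb, Category.assoc])).mpr
          ((MorphismProperty.isomorphisms.iff _).mpr step_c))
    have step_e : IsIso (blowupStrictTransformMap f b Q₂ ∣_ j.opensRange) :=
      (isIso_morphismRestrict_opensRange_iff f b Q₂ j hEQ₂).mpr step_d
    have hN' : j.opensRange = b₂ ⁻¹ᵁ Y₀ := by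
      ext1
      rw [Scheme.Hom.coe_opensRange, hj, Scheme.Pullback.range_fst, Scheme.Opens.range_ι]
      rfl
    exact (MorphismProperty.isomorphisms.iff _).mp
      (((MorphismProperty.isomorphisms Scheme.{u}).arrow_mk_iso_iff
        (morphismRestrictEq (blowupStrictTransformMap f b Q₂) hN')).mp
        ((MorphismProperty.isomorphisms.iff _).mpr step_e))

/-! ### Stacks 0F3X -/

/-- **One side of Stacks 0F3X.** For the scheme-theoretic image `Z` of `U → X₁ ×_S X₂` with
projection `p : Z → Xᵢ` (an isomorphism over `O = uᵢ(U)`), Tag 081S provides a normalised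
`O`-admissible blowing up `c : Xⁱ → Xᵢ` in `𝓘` such that the strict transform `T` of `p` is an
open `t : T → Xⁱ`; `q : T → Z` is the blowing up in `p⁻¹𝓘`. Given moreover an ideal sheaf `𝓚`
of finite type on `T` supported away from the points of `T` over `O`, there is a normalised
`O`-admissible blowing up `b = d ≫ c : X' → Xᵢ` and an open immersion `m : R → X'` from the
blowing up `r : R → T` of `T` in `𝓚` with `m ≫ d = r ≫ t`. This packages the steps "choose a
`U`-admissible blowup `Xᵢⁱ → Xᵢ` such that the strict transform `X₁₂ⁱ` is isomorphic to an open
subscheme of `Xᵢⁱ`" and "since `X₁₂ⁱ ⊂ Xᵢⁱ` is an open we may choose a `U`-admissible blowup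
`Xᵢ' → Xᵢⁱ` restricting to `X₁₂' → X₁₂ⁱ`" of the printed proof. Unconditional form of `exists_side`.
[cite: StacksProject, Tag 0F3X (proof)] -/
theorem stacks0F3X_side {Z Xi : Scheme.{u}} [CompactSpace Xi]
    [QuasiSeparatedSpace Xi] (p : Z ⟶ Xi) [IsSeparated p] [QuasiCompact p] [LocallyOfFiniteType p]
    (O : Xi.Opens) (hO : IsCompact (O : Set Xi)) [IsIso (p ∣_ O)] :
    ∃ (I : Xi.IdealSheafData) (Xii : Scheme.{u}) (c : Xii ⟶ Xi),
      (∀ W : Xi.affineOpens, (I.ideal W).FG) ∧ (I.support : Set Xi) = (O : Set Xi)ᶜ ∧ IsBlowup c I ∧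
      IsOpenImmersion (blowupStrictTransformMap p c I) ∧
      ∀ (K : (blowupStrictTransform p c I).IdealSheafData),
        (∀ W, (K.ideal W).FG) →
        Disjoint (((blowupStrictTransformι p c I ≫ pullback.fst p c) ⁻¹ᵁ (p ⁻¹ᵁ O) :
          (blowupStrictTransform p c I).Opens) : Set (blowupStrictTransform p c I)) (K.support) →
        ∀ {R : Scheme.{u}} (r : R ⟶ blowupStrictTransform p c I), IsBlowup r K →
        ∃ (Q : Xi.IdealSheafData) (X' : Scheme.{u}) (d : X' ⟶ Xii) (m : R ⟶ X'),
          (∀ W : Xi.affineOpens, (Q.ideal W).FG) ∧ (Q.support : Set Xi) = (O : Set Xi)ᶜ ∧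
          IsBlowup (d ≫ c) Q ∧ IsOpenImmersion m ∧ m ≫ d = r ≫ blowupStrictTransformMap p c I := by
  obtain ⟨I, Xii, c, hIfg, hIsupp, hc, hopen⟩ := stacks081S p O hO
  haveI := hopen
  haveI : IsProper c := IsBlowup.isProper_of_fg hIfg hc
  haveI : CompactSpace Xii := QuasiCompact.compactSpace_of_compactSpace c
  haveI : QuasiSeparatedSpace Xii := quasiSeparatedSpace_of_quasiSeparated c
  refine ⟨I, Xii, c, hIfg, hIsupp, hc, hopen, fun K hKfg hKdisj R r hr => ?_⟩
  set t := blowupStrictTransformMap p c I with ht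
  set q := blowupStrictTransformι p c I ≫ pullback.fst p c with hq
  have htc : t ≫ c = q ≫ p := by
    rw [hq, Category.assoc, pullback.condition, ← Category.assoc]; rfl
  -- the open `V = t(T)` and `τ : T ≅ V`
  set V : Xii.Opens := t.opensRange with hV
  set τ := t.isoOpensRange with hτ
  -- `T` is quasi-compact, so `V` is
  haveI : CompactSpace Z := by
    haveI : IsIso (p ∣_ O) := inferInstance
    -- `Z` is quasi-compact over the quasi-compact `Xi`
    exact QuasiCompact.compactSpace_of_compactSpace p
  have hE : IsEffectiveCartier (I.comap c) := hc.isEffectiveCartier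
  haveI : IsProper (pullback.fst p c) := inferInstance
  haveI : CompactSpace (blowupStrictTransform p c I) :=
    QuasiCompact.compactSpace_of_compactSpace q
  have hVc : IsCompact (V : Set Xii) := isCompact_range t.continuous
  -- the centre `𝓚` moved to `V` does not meet the part of `Xⁱ` over `O`
  set K' := K.comap τ.inv with hK'
  have hK'fg : ∀ W, (K'.ideal W).FG := fg_ideal_comap τ.inv hKfg
  have hK'disj : Disjoint ((V.ι ⁻¹ᵁ (c ⁻¹ᵁ O) : (V : Scheme.{u}).Opens) : Set (V : Scheme.{u}))
      (K'.support : Set (V : Scheme.{u})) := by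
    refine Set.disjoint_left.mpr fun v hv hvK => ?_
    rw [hK', Scheme.IdealSheafData.support_comap] at hvK
    refine Set.disjoint_left.mp hKdisj ?_ hvK
    -- `q (τ⁻¹ v)` lies over `O` because `c (t (τ⁻¹ v)) = c v` does
    show p (q (τ.inv v)) ∈ O
    have h1 : t (τ.inv v) = V.ι v := by
      rw [← Scheme.Hom.comp_apply, hτ, Scheme.Hom.isoOpensRange_inv_comp]
    rw [← Scheme.Hom.comp_apply, ← htc, Scheme.Hom.comp_apply, h1]
    exact hv
  -- extend it to a `c⁻¹O`-admissible centre `G` on `Xⁱ` (Stacks 080M) and blow up, normalised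
  obtain ⟨G, hGfg, hGcomap, hGO⟩ := exists_fg_comap_ι_eq_of_disjoint (c ⁻¹ᵁ O) (c.isCompact_preimage hO)
    V hVc K' hK'fg hK'disj
  obtain ⟨X', d, hd⟩ := exists_isBlowup Xii G
  obtain ⟨hd', hG'fg, hG'supp, Q, hQfg, hQsupp, hbQ⟩ := hc.normalised_comp hIfg hIsupp hd hGfg hGO
  -- over `V`, `d` is the blowing up of `V` in `K' · L`, as is `r ≫ τ`
  set L := (I.comap c).comap V.ι with hL
  have hLc : IsEffectiveCartier L := hE.comap_of_isOpenImmersion V.ι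
  have hGV : (G * I.comap c).comap V.ι = K' * L := by rw [comap_mul, hGcomap]
  have hdV : IsBlowup (d ∣_ V) (K' * L) := hGV ▸ hd'.restrict V
  have hrV : IsBlowup (r ≫ τ.hom) (K' * L) := (hr.comp_iso τ).mul_of_isEffectiveCartier hLc
  obtain ⟨ε, hε, -⟩ := hrV.unique hdV
  refine ⟨Q, X', d, ε.hom ≫ (d ⁻¹ᵁ V).ι, hQfg, hQsupp, hbQ, inferInstance, ?_⟩
  rw [Category.assoc, ← morphismRestrict_ι, ← Category.assoc ε.hom, hε, Category.assoc]
  show r ≫ t.isoOpensRange.hom ≫ t.opensRange.ι = r ≫ t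
  rw [Scheme.Hom.isoOpensRange_hom_ι]


/-- **Stacks 0F3X.** For open
immersions `uᵢ : U → Xᵢ` over a quasi-compact quasi-separated `S` (`u₁ ≫ g₁ = u₂ ≫ g₂`), with
`Xᵢ → S` separated and of finite type and `U` quasi-compact, there are `U`-admissible blowing ups
`Xᵢ' → Xᵢ`, a scheme `X` separated and of finite type over `S` and open immersions `Xᵢ' → X`
over `S` under which the two lifts of `U` agree (`GluingData`). Unconditional form of
`stacks0F3X_of_stacks081R` (same proof, see the docstring of `GluingAfterBlowup.lean`).
[cite: StacksProject, Tag 0F3X] -/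
theorem stacks0F3X {S U X₁ X₂ : Scheme.{u}} [CompactSpace S] [QuasiSeparatedSpace S] (g₁ : X₁ ⟶ S)
    (g₂ : X₂ ⟶ S) [IsSeparated g₁] [LocallyOfFiniteType g₁] [QuasiCompact g₁]
    [IsSeparated g₂] [LocallyOfFiniteType g₂] [QuasiCompact g₂]
    (u₁ : U ⟶ X₁) (u₂ : U ⟶ X₂) [IsOpenImmersion u₁] [IsOpenImmersion u₂] [QuasiCompact u₁]
    (hu : u₁ ≫ g₁ = u₂ ≫ g₂) : Nonempty (GluingData g₁ g₂ u₁ u₂) := by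
  haveI : CompactSpace X₁ := QuasiCompact.compactSpace_of_compactSpace g₁
  haveI : CompactSpace X₂ := QuasiCompact.compactSpace_of_compactSpace g₂
  haveI : QuasiSeparatedSpace X₁ := quasiSeparatedSpace_of_quasiSeparated g₁
  haveI : QuasiSeparatedSpace X₂ := quasiSeparatedSpace_of_quasiSeparated g₂
  haveI : CompactSpace U := QuasiCompact.compactSpace_of_compactSpace u₁
  /- Step A: the scheme-theoretic image `Z` of `U → X₁ ×_S X₂` and its projections -/
  set γ : U ⟶ pullback g₁ g₂ := pullback.lift u₁ u₂ hu with hγ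
  have hγ₁ : γ ≫ pullback.fst g₁ g₂ = u₁ := pullback.lift_fst _ _ _
  have hγ₂ : γ ≫ pullback.snd g₁ g₂ = u₂ := pullback.lift_snd _ _ _
  haveI : QuasiSeparatedSpace (↥(pullback g₁ g₂ : Scheme.{u})) :=
    quasiSeparatedSpace_of_quasiSeparated (pullback.snd g₁ g₂)
  haveI : QuasiCompact γ := inferInstance
  set ι := γ.imageι with hι
  set s := γ.toImage with hs
  set p₁ : γ.image ⟶ X₁ := ι ≫ pullback.fst g₁ g₂ with hp₁
  set p₂ : γ.image ⟶ X₂ := ι ≫ pullback.snd g₁ g₂ with hp₂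
  haveI : IsSeparated p₁ := inferInstance
  haveI : IsSeparated p₂ := inferInstance
  have hpg : p₁ ≫ g₁ = p₂ ≫ g₂ := by
    simp only [hp₁, hp₂, Category.assoc, pullback.condition]
  have hsp₁ : s ≫ p₁ = u₁ := by rw [hs, hp₁, Scheme.Hom.toImage_imageι_assoc, hγ₁]
  have hsp₂ : s ≫ p₂ = u₂ := by rw [hs, hp₂, Scheme.Hom.toImage_imageι_assoc, hγ₂]
  haveI : LocallyOfFiniteType p₁ := inferInstance
  haveI : LocallyOfFiniteType p₂ := inferInstance
  haveI : QuasiCompact p₁ := inferInstance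
  haveI : QuasiCompact p₂ := inferInstance
  set O₁ : X₁.Opens := u₁.opensRange with hO₁
  set O₂ : X₂.Opens := u₂.opensRange with hO₂
  have hO₁c : IsCompact (O₁ : Set X₁) := isCompact_range u₁.continuous
  have hO₂c : IsCompact (O₂ : Set X₂) := isCompact_range u₂.continuous
  haveI : QuasiCompact u₂ := inferInstance
  haveI : IsIso (p₁ ∣_ O₁) := GraphClosure.isIso_morphismRestrict u₁ (pullback.fst g₁ g₂) γ hγ₁
  haveI : IsIso (p₂ ∣_ O₂) := GraphClosure.isIso_morphismRestrict u₂ (pullback.snd g₁ g₂) γ hγ₂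
  have hrange₁ : Set.range s = ((p₁ ⁻¹ᵁ O₁ : (γ.image).Opens) : Set γ.image) :=
    (GraphClosure.isOpenImmersion_toImage_and_range u₁ (pullback.fst g₁ g₂) γ hγ₁).2
  have hrange₂ : Set.range s = ((p₂ ⁻¹ᵁ O₂ : (γ.image).Opens) : Set γ.image) :=
    (GraphClosure.isOpenImmersion_toImage_and_range u₂ (pullback.snd g₁ g₂) γ hγ₂).2
  /- Step B (081S on both sides) -/
  obtain ⟨I₁, X₁i, c₁, hI₁fg, hI₁supp, hc₁, hopen₁, hside₁⟩ := stacks0F3X_side p₁ O₁ hO₁c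
  obtain ⟨I₂, X₂i, c₂, hI₂fg, hI₂supp, hc₂, hopen₂, hside₂⟩ := stacks0F3X_side p₂ O₂ hO₂c
  haveI : IsProper c₁ := IsBlowup.isProper_of_fg hI₁fg hc₁
  haveI : IsProper c₂ := IsBlowup.isProper_of_fg hI₂fg hc₂
  set t₁ := blowupStrictTransformMap p₁ c₁ I₁ with ht₁
  set t₂ := blowupStrictTransformMap p₂ c₂ I₂ with ht₂
  set q₁ := blowupStrictTransformι p₁ c₁ I₁ ≫ pullback.fst p₁ c₁ with hq₁
  set q₂ := blowupStrictTransformι p₂ c₂ I₂ ≫ pullback.fst p₂ c₂ with hq₂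
  haveI : IsProper q₁ := inferInstance
  haveI : IsProper q₂ := inferInstance
  have htc₁ : t₁ ≫ c₁ = q₁ ≫ p₁ := by
    rw [ht₁, hq₁, Category.assoc, pullback.condition]
    change (blowupStrictTransformι p₁ c₁ I₁ ≫ pullback.snd p₁ c₁) ≫ c₁ = _
    rw [Category.assoc]
  have htc₂ : t₂ ≫ c₂ = q₂ ≫ p₂ := by
    rw [ht₂, hq₂, Category.assoc, pullback.condition]
    change (blowupStrictTransformι p₂ c₂ I₂ ≫ pullback.snd p₂ c₂) ≫ c₂ = _
    rw [Category.assoc]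
  set J₁ := I₁.comap p₁ with hJ₁
  set J₂ := I₂.comap p₂ with hJ₂
  have hq₁b : IsBlowup q₁ J₁ := isBlowup_blowupStrictTransform p₁ c₁ I₁ hc₁
  have hq₂b : IsBlowup q₂ J₂ := isBlowup_blowupStrictTransform p₂ c₂ I₂ hc₂
  have hJ₁fg : ∀ W, (J₁.ideal W).FG := fg_ideal_comap p₁ hI₁fg
  have hJ₂fg : ∀ W, (J₂.ideal W).FG := fg_ideal_comap p₂ hI₂fg
  have hJ₁supp : (J₁.support : Set γ.image) = ((p₁ ⁻¹ᵁ O₁ : (γ.image).Opens) : Set γ.image)ᶜ := by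
    rw [hJ₁, Scheme.IdealSheafData.support_comap]
    ext x
    change p₁ x ∈ (I₁.support : Set X₁) ↔ ¬ (p₁ x ∈ (O₁ : Set X₁))
    rw [hI₁supp, Set.mem_compl_iff]
  have hJ₂supp : (J₂.support : Set γ.image) = ((p₁ ⁻¹ᵁ O₁ : (γ.image).Opens) : Set γ.image)ᶜ := by
    rw [hJ₂, Scheme.IdealSheafData.support_comap, ← hrange₁, hrange₂]
    ext x
    change p₂ x ∈ (I₂.support : Set X₂) ↔ ¬ (p₂ x ∈ (O₂ : Set X₂))
    rw [hI₂supp, Set.mem_compl_iff]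
  /- Step C: the common refinement `R = Bl_{J₁ J₂}(Z)` -/
  obtain ⟨R, r₁, hr₁⟩ := exists_isBlowup (blowupStrictTransform p₁ c₁ I₁) (J₂.comap q₁)
  obtain ⟨R', r₂, hr₂⟩ := exists_isBlowup (blowupStrictTransform p₂ c₂ I₂) (J₁.comap q₂)
  have hρ₁ : IsBlowup (r₁ ≫ q₁) (J₁ * J₂) := hq₁b.comp hr₁
  have hρ₂ : IsBlowup (r₂ ≫ q₂) (J₁ * J₂) := by rw [mul_comm]; exact hq₂b.comp hr₂
  obtain ⟨e, he, -⟩ := hρ₁.unique hρ₂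
  haveI : IsProper r₁ := IsBlowup.isProper_of_fg (fg_ideal_comap q₁ hJ₂fg) hr₁
  /- Step D: blow up `X₁ⁱ`, `X₂ⁱ` further so that `R` becomes an open of both -/
  have hK₁disj : Disjoint (((blowupStrictTransformι p₁ c₁ I₁ ≫ pullback.fst p₁ c₁) ⁻¹ᵁ (p₁ ⁻¹ᵁ O₁) :
      (blowupStrictTransform p₁ c₁ I₁).Opens) : Set (blowupStrictTransform p₁ c₁ I₁))
      ((J₂.comap q₁).support) := by
    rw [Scheme.IdealSheafData.support_comap]
    refine Set.disjoint_left.mpr fun x hx hx' => ?_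
    have hx'' : q₁ x ∈ (J₂.support : Set γ.image) := hx'
    rw [hJ₂supp] at hx''
    exact hx'' hx
  have hK₂disj : Disjoint (((blowupStrictTransformι p₂ c₂ I₂ ≫ pullback.fst p₂ c₂) ⁻¹ᵁ (p₂ ⁻¹ᵁ O₂) :
      (blowupStrictTransform p₂ c₂ I₂).Opens) : Set (blowupStrictTransform p₂ c₂ I₂))
      ((J₁.comap q₂).support) := by
    rw [Scheme.IdealSheafData.support_comap]
    refine Set.disjoint_left.mpr fun x hx hx' => ?_
    have hx'' : q₂ x ∈ (J₁.support : Set γ.image) := hx'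
    rw [hJ₁supp] at hx''
    have hx3 : q₂ x ∈ ((p₁ ⁻¹ᵁ O₁ : (γ.image).Opens) : Set γ.image) := by
      rw [← hrange₁, hrange₂]; exact hx
    exact hx'' hx3
  obtain ⟨Q₁, X₁', d₁, m₁, hQ₁fg, hQ₁supp, hb₁, hm₁, hm₁d⟩ :=
    hside₁ (J₂.comap q₁) (fg_ideal_comap q₁ hJ₂fg) hK₁disj r₁ hr₁
  obtain ⟨Q₂, X₂', d₂, m₂, hQ₂fg, hQ₂supp, hb₂, hm₂, hm₂d⟩ :=
    hside₂ (J₁.comap q₂) (fg_ideal_comap q₂ hJ₁fg) hK₂disj r₂ hr₂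
  haveI := hm₁
  haveI := hm₂
  obtain ⟨b₁, hb₁def⟩ : ∃ b : X₁' ⟶ X₁, b = d₁ ≫ c₁ := ⟨_, rfl⟩
  obtain ⟨b₂, hb₂def⟩ : ∃ b : X₂' ⟶ X₂, b = d₂ ≫ c₂ := ⟨_, rfl⟩
  rw [← hb₁def] at hb₁
  rw [← hb₂def] at hb₂
  haveI : IsProper b₁ := IsBlowup.isProper_of_fg hQ₁fg hb₁
  haveI : IsProper b₂ := IsBlowup.isProper_of_fg hQ₂fg hb₂
  haveI : CompactSpace X₁' := QuasiCompact.compactSpace_of_compactSpace b₁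
  haveI : CompactSpace X₂' := QuasiCompact.compactSpace_of_compactSpace b₂
  set m₂' := e.hom ≫ m₂ with hm₂'
  haveI : IsOpenImmersion m₂' := by rw [hm₂']; infer_instance
  -- the key equations
  have hm₁b : m₁ ≫ b₁ = (r₁ ≫ q₁) ≫ p₁ := by
    rw [hb₁def, ← Category.assoc, hm₁d, Category.assoc, htc₁]
    simp only [hq₁, Category.assoc]
  have hm₂b : m₂' ≫ b₂ = (r₁ ≫ q₁) ≫ p₂ := by
    rw [hb₂def, hm₂', Category.assoc, ← Category.assoc m₂, hm₂d, Category.assoc, htc₂,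
      ← Category.assoc r₂ q₂ p₂, ← Category.assoc e.hom (r₂ ≫ q₂) p₂, he]
  have w : m₁ ≫ b₁ ≫ g₁ = m₂' ≫ b₂ ≫ g₂ := by
    rw [← Category.assoc, hm₁b, ← Category.assoc m₂', hm₂b, Category.assoc, Category.assoc, hpg]
    simp only [Category.assoc]
  /- Step E: glue -/
  haveI := Limits.isOpenImmersion_inl m₁ m₂'
  haveI := Limits.isOpenImmersion_inr m₁ m₂'
  have hclosed : IsClosed (Set.range (pullback.lift m₁ m₂' w : R ⟶ pullback (b₁ ≫ g₁) (b₂ ≫ g₂))) := by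
    set Γ := pullback.lift m₁ m₂' w with hΓ
    set β := pullback.map (b₁ ≫ g₁) (b₂ ≫ g₂) g₁ g₂ b₁ b₂ (𝟙 S)
      (by rw [Category.comp_id]) (by rw [Category.comp_id]) with hβ
    haveI : IsSeparated β :=
      MorphismProperty.pullbackMap (P := @IsSeparated) (f := b₁ ≫ g₁) (g := b₂ ≫ g₂)
        (f' := g₁) (g' := g₂) (i₁ := b₁) (i₂ := b₂) inferInstance inferInstance rfl rfl
    have hΓβ : Γ ≫ β = (r₁ ≫ q₁) ≫ ι := by
      apply pullback.hom_ext
      · rw [Category.assoc, Category.assoc, hβ, pullback.lift_fst, ← Category.assoc, hΓ, pullback.lift_fst,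
          hm₁b]
      · rw [Category.assoc, Category.assoc, hβ, pullback.lift_snd, ← Category.assoc, hΓ, pullback.lift_snd,
          hm₂b]
    haveI : UniversallyClosed (Γ ≫ β) := by rw [hΓβ]; infer_instance
    haveI : UniversallyClosed Γ := .of_comp_of_isSeparated Γ β
    exact Γ.isClosedMap.isClosed_range
  haveI : IsSeparated (pushout.desc (b₁ ≫ g₁) (b₂ ≫ g₂) w) :=
    isSeparated_pushoutDesc m₁ m₂' _ _ w hclosed
  haveI : LocallyOfFiniteType (pushout.desc (b₁ ≫ g₁) (b₂ ≫ g₂) w) :=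
    Limits.locallyOfFiniteType_pushoutDesc m₁ m₂' _ _ w
  haveI : QuasiCompact (pushout.desc (b₁ ≫ g₁) (b₂ ≫ g₂) w) :=
    Limits.quasiCompact_pushoutDesc m₁ m₂' _ _ w
  /- Step F: the lifts of `U` -/
  haveI : IsIso (b₁ ∣_ O₁) := IsBlowup.isIso_morphismRestrict_of_support_eq hb₁ hQ₁supp
  haveI : IsIso (b₂ ∣_ O₂) := IsBlowup.isIso_morphismRestrict_of_support_eq hb₂ hQ₂supp
  have hu₁O : Set.range u₁ ⊆ (O₁ : Set X₁) := subset_of_eq (Scheme.Hom.coe_opensRange u₁).symm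
  have hu₂O : Set.range u₂ ⊆ (O₂ : Set X₂) := subset_of_eq (Scheme.Hom.coe_opensRange u₂).symm
  set u₁' := liftOfIsIsoMorphismRestrict b₁ O₁ u₁ hu₁O with hu₁'
  set u₂' := liftOfIsIsoMorphismRestrict b₂ O₂ u₂ hu₂O with hu₂'
  haveI : IsOpenImmersion u₁' := isOpenImmersion_liftOfIsIsoMorphismRestrict _ _ _ _
  haveI : IsOpenImmersion u₂' := isOpenImmersion_liftOfIsIsoMorphismRestrict _ _ _ _
  -- `U → R` through the isomorphism locus of `R → Z`
  have hρsupp : ((J₁ * J₂).support : Set γ.image) = ((p₁ ⁻¹ᵁ O₁ : (γ.image).Opens) : Set γ.image)ᶜ := by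
    rw [Scheme.IdealSheafData.support_mul, TopologicalSpace.Closeds.coe_sup, hJ₁supp, hJ₂supp, Set.union_self]
  haveI : IsIso ((r₁ ≫ q₁) ∣_ (p₁ ⁻¹ᵁ O₁)) := IsBlowup.isIso_morphismRestrict_of_support_eq hρ₁ hρsupp
  set wR := liftOfIsIsoMorphismRestrict (r₁ ≫ q₁) (p₁ ⁻¹ᵁ O₁) s (subset_of_eq hrange₁) with hwR
  have hwRq : wR ≫ r₁ ≫ q₁ = s := liftOfIsIsoMorphismRestrict_comp _ _ _ _
  have hw₁ : wR ≫ m₁ = u₁' := by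
    refine ext_of_isIso_morphismRestrict b₁ O₁ ?_ ?_
    · rw [Category.assoc, hm₁b, ← Category.assoc, hwRq, hu₁', liftOfIsIsoMorphismRestrict_comp, hsp₁]
    · rw [Category.assoc, hm₁b, ← Category.assoc, hwRq, hsp₁]
      exact hu₁O
  have hw₂ : wR ≫ m₂' = u₂' := by
    refine ext_of_isIso_morphismRestrict b₂ O₂ ?_ ?_
    · rw [Category.assoc, hm₂b, ← Category.assoc, hwRq, hu₂', liftOfIsIsoMorphismRestrict_comp, hsp₂]
    · rw [Category.assoc, hm₂b, ← Category.assoc, hwRq, hsp₂]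
      exact hu₂O
  have hcond : u₁' ≫ pushout.inl m₁ m₂' = u₂' ≫ pushout.inr m₁ m₂' := by
    rw [← hw₁, ← hw₂, Category.assoc, Category.assoc, pushout.condition]
  exact ⟨{
    X₁' := X₁', X₂' := X₂', X := pushout m₁ m₂', b₁ := b₁, b₂ := b₂, Q₁ := Q₁, Q₂ := Q₂,
    i₁ := pushout.inl m₁ m₂', i₂ := pushout.inr m₁ m₂',
    g := pushout.desc (b₁ ≫ g₁) (b₂ ≫ g₂) w, u₁' := u₁', u₂' := u₂',
    fg₁ := hQ₁fg, fg₂ := hQ₂fg,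
    supp₁ := by rw [hQ₁supp, hO₁, Scheme.Hom.coe_opensRange],
    supp₂ := by rw [hQ₂supp, hO₂, Scheme.Hom.coe_opensRange],
    isBlowup₁ := hb₁, isBlowup₂ := hb₂,
    i₁_g := pushout.inl_desc _ _ _,
    i₂_g := pushout.inr_desc _ _ _,
    u₁'_b₁ := liftOfIsIsoMorphismRestrict_comp _ _ _ _,
    u₂'_b₂ := liftOfIsIsoMorphismRestrict_comp _ _ _ _,
    u₁'_i₁ := hcond,
    range_i₁_union_range_i₂ := Limits.range_inl_union_range_inr m₁ m₂' }⟩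

/-! ## Compactifications: Tags 0F3Z, 0F40, base-locality, 0F41 -/

/-! ### Stacks 0F3Z -/

/-- **Stacks 0F3Z.** Let `S` be
quasi-compact and quasi-separated, `g : U → S` separated and of finite type, `j : V → U` a
quasi-compact open immersion, and `V → Y → S` a compactification of `V` over `S` (`jY` an open
immersion, `πY` proper, `jY ≫ πY = j ≫ g`). Then there are a compactification `V → Y' → S` of `V`
over `S` (obtained from `Y` by a `V`-admissible blowing up), an open `V' ⊆ Y'` containing `V`
(`sV : V → V'` with `sV ≫ (V' ↪ Y') = (V → Y')`) and a PROPER morphism `ψ : V' → U` over `S`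
extending `j` (`sV ≫ ψ = j`), which moreover is an isomorphism over `j(V) ⊆ U`. Unconditional form of
`stacks0F3Z_of_stacks081R` (same proof, with `stacks081S`). [cite: StacksProject, Tag 0F3Z] -/
theorem stacks0F3Z {S U V Y : Scheme.{u}} [CompactSpace S]
    [QuasiSeparatedSpace S] (g : U ⟶ S) [IsSeparated g] [LocallyOfFiniteType g] [QuasiCompact g]
    (j : V ⟶ U) [IsOpenImmersion j] [QuasiCompact j] (jY : V ⟶ Y) [IsOpenImmersion jY]
    (πY : Y ⟶ S) [IsProper πY] (hcomm : jY ≫ πY = j ≫ g) :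
    ∃ (Y' : Scheme.{u}) (jY' : V ⟶ Y') (πY' : Y' ⟶ S) (V' : Y'.Opens) (ψ : (V' : Scheme.{u}) ⟶ U)
      (sV : V ⟶ V'), IsOpenImmersion jY' ∧ IsProper πY' ∧ jY' ≫ πY' = j ≫ g ∧ IsProper ψ ∧
      sV ≫ V'.ι = jY' ∧ sV ≫ ψ = j ∧ ψ ≫ g = V'.ι ≫ πY' ∧ IsIso (ψ ∣_ j.opensRange) := by
  /- quasi-compactness bookkeeping -/
  haveI : CompactSpace U := QuasiCompact.compactSpace_of_compactSpace g
  haveI : CompactSpace V := QuasiCompact.compactSpace_of_compactSpace j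
  haveI : CompactSpace Y := QuasiCompact.compactSpace_of_compactSpace πY
  haveI : QuasiSeparatedSpace Y := quasiSeparatedSpace_of_quasiSeparated πY
  haveI : QuasiSeparatedSpace U := quasiSeparatedSpace_of_quasiSeparated g
  /- the "diagonal" `γ : V → Y ×_S U` and its scheme-theoretic image `Z` -/
  set pr₁ := pullback.fst πY g with hpr₁
  set pr₂ := pullback.snd πY g with hpr₂
  set γ : V ⟶ pullback πY g := pullback.lift jY j hcomm with hγ
  have hγ₁ : γ ≫ pr₁ = jY := pullback.lift_fst _ _ _
  have hγ₂ : γ ≫ pr₂ = j := pullback.lift_snd _ _ _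
  haveI : QuasiSeparatedSpace (↥(pullback πY g : Scheme.{u})) := quasiSeparatedSpace_of_quasiSeparated pr₂
  haveI : QuasiCompact γ := inferInstance
  set Z := γ.image with hZ
  set ιZ := γ.imageι with hιZ
  set sZ := γ.toImage with hsZ
  set p : Z ⟶ Y := ιZ ≫ pr₁ with hp
  set r : Z ⟶ U := ιZ ≫ pr₂ with hr
  haveI : IsSeparated p := inferInstance
  haveI : LocallyOfFiniteType p := inferInstance
  haveI : QuasiCompact p := inferInstance
  haveI : IsProper r := inferInstance
  -- `Z → Y` is an isomorphism over `W = jY(V)`, `Z → U` over `j(V)`, both with preimage `sZ(V)`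
  set W : Y.Opens := jY.opensRange with hW
  haveI hpW : IsIso (p ∣_ W) := GraphClosure.isIso_morphismRestrict jY pr₁ γ hγ₁
  haveI hrV : IsIso (r ∣_ j.opensRange) := GraphClosure.isIso_morphismRestrict j pr₂ γ hγ₂
  have hrange₁ := (GraphClosure.isOpenImmersion_toImage_and_range jY pr₁ γ hγ₁).2
  have hrange₂ := (GraphClosure.isOpenImmersion_toImage_and_range j pr₂ γ hγ₂).2
  have hpre : r ⁻¹ᵁ j.opensRange = p ⁻¹ᵁ W := by
    apply Opens.ext
    exact hrange₂.symm.trans hrange₁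
  have hWc : IsCompact (W : Set Y) := isCompact_range jY.continuous
  /- Stacks 081S: after a `W`-admissible blowing up `b : Y' → Y`, the strict transform
    `c : Z' → Y'` of `Z → Y` is an open immersion -/
  obtain ⟨Q, Y', b, hQfg, hQsupp, hb, hopen⟩ := stacks081S p W hWc
  have hcc : centreCompl Q = W := centreCompl_eq_of_support_eq hQsupp
  have hE : IsEffectiveCartier (Q.comap b) := hb.isEffectiveCartier
  haveI : IsProper b := IsBlowup.isProper_of_fg hQfg hb
  haveI hbW : IsIso (b ∣_ W) := by rw [← hcc]; exact hb.isIso_compl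
  set c := blowupStrictTransformMap p b Q with hc
  haveI : IsOpenImmersion c := hopen
  set ιZ' := blowupStrictTransformι p b Q with hιZ'
  set bZ : blowupStrictTransform p b Q ⟶ Z := ιZ' ≫ pullback.fst p b with hbZ
  haveI : IsProper bZ := inferInstance
  -- the open `V' = c(Z') ⊆ Y'` and `e : Z' ≅ V'`
  set V' : Y'.Opens := c.opensRange with hV'
  set e := c.isoOpensRange with he
  -- the new embedding `jY' : V → Y'` (through `b⁻¹(W) ≅ W ≅ V`)
  set jY' : V ⟶ Y' := jY.isoOpensRange.hom ≫ inv (b ∣_ W) ≫ (b ⁻¹ᵁ W).ι with hjY'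
  have hjY'b : jY' ≫ b = jY := by
    rw [hjY', Category.assoc, Category.assoc, ← morphismRestrict_ι, IsIso.inv_hom_id_assoc,
      Scheme.Hom.isoOpensRange_hom_ι]
  haveI : IsOpenImmersion jY' := by rw [hjY']; infer_instance
  -- `V → Z ×_Y Y'` lands in the open over `b⁻¹(W)`, where the strict transform is everything
  set t₀ : V ⟶ pullback p b := pullback.lift sZ jY' (by
    rw [hjY'b, hsZ, hp, Scheme.Hom.toImage_imageι_assoc, hγ₁]) with ht₀
  have ht₀range : Set.range t₀ ⊆
      Set.range ((pullback.snd p b) ⁻¹ᵁ (b ⁻¹ᵁ centreCompl Q)).ι := by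
    rw [Scheme.Opens.range_ι]
    rintro _ ⟨v, rfl⟩
    show b (pullback.snd p b (t₀ v)) ∈ centreCompl Q
    rw [← Scheme.Hom.comp_apply, ← Scheme.Hom.comp_apply, pullback.lift_snd_assoc, hjY'b, hcc]
    exact ⟨v, rfl⟩
  set t₁ := IsOpenImmersion.lift _ t₀ ht₀range with ht₁
  have ht₁ι : t₁ ≫ ((pullback.snd p b) ⁻¹ᵁ (b ⁻¹ᵁ centreCompl Q)).ι = t₀ :=
    IsOpenImmersion.lift_fac _ _ _
  set sZ' : V ⟶ blowupStrictTransform p b Q :=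
    t₁ ≫ ((pullback.snd p b) ⁻¹ᵁ (b ⁻¹ᵁ centreCompl Q)).ι.toImage with hsZ'
  have hsZ'ι : sZ' ≫ ιZ' = t₀ := by
    rw [hsZ', Category.assoc]
    change t₁ ≫ (((pullback.snd p b) ⁻¹ᵁ (b ⁻¹ᵁ centreCompl Q)).ι.toImage ≫
      ((pullback.snd p b) ⁻¹ᵁ (b ⁻¹ᵁ centreCompl Q)).ι.imageι) = t₀
    rw [Scheme.Hom.toImage_imageι, ht₁ι]
  have hsZ'c : sZ' ≫ c = jY' := by
    change sZ' ≫ ιZ' ≫ pullback.snd p b = jY'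
    rw [← Category.assoc, hsZ'ι, ht₀, pullback.lift_snd]
  have hsZ'bZ : sZ' ≫ bZ = sZ := by
    rw [hbZ, ← Category.assoc, hsZ'ι, ht₀, pullback.lift_fst]
  -- the data
  set sV : V ⟶ V' := sZ' ≫ e.hom with hsV
  set ψ : (V' : Scheme.{u}) ⟶ U := e.inv ≫ bZ ≫ r with hψ
  have heι : e.hom ≫ V'.ι = c := Scheme.Hom.isoOpensRange_hom_ι c
  have heinv : e.inv ≫ c = V'.ι := Scheme.Hom.isoOpensRange_inv_comp c
  refine ⟨Y', jY', b ≫ πY, V', ψ, sV, inferInstance, inferInstance, ?_, ?_, ?_, ?_, ?_, ?_⟩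
  · rw [← Category.assoc, hjY'b, hcomm]
  · rw [hψ]; infer_instance
  · rw [hsV, Category.assoc, heι, hsZ'c]
  · rw [hsV, hψ, Category.assoc, e.hom_inv_id_assoc, ← Category.assoc, hsZ'bZ, hsZ, hr,
      Scheme.Hom.toImage_imageι_assoc, hγ₂]
  · -- `ψ ≫ g = V'.ι ≫ b ≫ πY`
    have h1 : bZ ≫ r ≫ g = c ≫ b ≫ πY := by
      rw [hr, hbZ, hpr₂]
      simp only [Category.assoc]
      rw [← pullback.condition, ← hpr₁, ← Category.assoc ιZ pr₁ πY, ← hp,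
        ← Category.assoc (pullback.fst p b) p πY, pullback.condition, Category.assoc, hc, hιZ']
      change blowupStrictTransformι p b Q ≫ pullback.snd p b ≫ b ≫ πY =
        (blowupStrictTransformι p b Q ≫ pullback.snd p b) ≫ b ≫ πY
      rw [Category.assoc]
    rw [hψ, Category.assoc, Category.assoc, h1, ← Category.assoc, heinv]
  · -- `ψ` is an isomorphism over `j(V)`: `r` is, `bZ` is over `r⁻¹(j(V)) = p⁻¹(W)`, `e.inv` is
    haveI h2 : IsIso (bZ ∣_ r ⁻¹ᵁ j.opensRange) := by
      rw [hpre, hbZ]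
      haveI : IsIso (pullback.fst p b ∣_ p ⁻¹ᵁ W) := isIso_morphismRestrict_pullback_fst p b W
      haveI : IsIso (ιZ' ∣_ (pullback.fst p b) ⁻¹ᵁ (p ⁻¹ᵁ W)) := by
        have hO : (pullback.fst p b) ⁻¹ᵁ (p ⁻¹ᵁ W) =
            (pullback.snd p b) ⁻¹ᵁ (b ⁻¹ᵁ centreCompl Q) := by
          rw [← Scheme.Hom.comp_preimage, pullback.condition, Scheme.Hom.comp_preimage, hcc]
        rw [hO, hιZ']
        exact isIso_blowupStrictTransformι_morphismRestrict p b Q hE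
      exact isIso_morphismRestrict_comp ιZ' (pullback.fst p b) (p ⁻¹ᵁ W)
    haveI h3 : IsIso (e.inv ∣_ (bZ ≫ r) ⁻¹ᵁ j.opensRange) :=
      (MorphismProperty.isomorphisms.iff _).mp
        (IsZariskiLocalAtTarget.restrict ((MorphismProperty.isomorphisms.iff _).mpr inferInstance) _)
    haveI h4 : IsIso ((bZ ≫ r) ∣_ j.opensRange) := isIso_morphismRestrict_comp bZ r _
    rw [hψ]
    exact isIso_morphismRestrict_comp e.inv (bZ ≫ r) _


namespace ExtData

variable {U S : Scheme.{u}} {g : U ⟶ S} {U₁ U₂ : U.Opens}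

/-- **Existence (Tag 0F3Z)**: if `Uᵢ` is quasi-compact and
compactifiable over `S` (with `g` separated of finite type, `S` quasi-compact and
quasi-separated), the extension data exists. Unconditional form of `nonempty_of_compactification`.
[cite: StacksProject, Tag 0F40 (proof)] -/
theorem nonempty_of_exists_compactification [CompactSpace S] [QuasiSeparatedSpace S]
    (g : U ⟶ S) [IsSeparated g] [LocallyOfFiniteType g] [QuasiCompact g] (Ui : U.Opens)
    (hUi : IsCompact (Ui : Set U))
    (h : ∃ (Y : Scheme.{u}) (j : (Ui : Scheme.{u}) ⟶ Y) (π : Y ⟶ S),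
      IsOpenImmersion j ∧ IsProper π ∧ j ≫ π = Ui.ι ≫ g) :
    Nonempty (ExtData g Ui) := by
  obtain ⟨Y, j, π, hj, hπ, hcomm⟩ := h
  haveI := hj
  haveI := hπ
  haveI : QuasiSeparatedSpace U := quasiSeparatedSpace_of_quasiSeparated g
  haveI : QuasiCompact Ui.ι := Limits.quasiCompact_ι_of_isCompact Ui hUi
  obtain ⟨Y', jY', πY', V', ψ, sV, hjY', hπY', hcomm', hψ, hsV, hsVψ, hψg, hiso⟩ :=
    stacks0F3Z g Ui.ι j π hcomm
  haveI := hjY'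
  haveI := hπY'
  haveI := hψ
  rw [Scheme.Opens.opensRange_ι] at hiso
  exact ⟨ExtData.mk (X := Y') (jX := jY') (πX := πY') (V := V') (ψ := ψ) (sV := sV) hcomm' hsV
    hsVψ hψg hiso⟩


section Near

variable (E₁ : ExtData g U₁) (E₂ : ExtData g U₂) [CompactSpace E₁.X] [QuasiSeparatedSpace E₁.X]
  [CompactSpace (pullback E₁.ψ E₂.ψ : Scheme.{u})]

set_option maxHeartbeats 800000 in
/-- **After a further (normalised) `V₁`-admissible blowing up, `p₁ : X₁₂ → X₁` is an isomorphism
over an open neighbourhood of `Z̄₁,₂`** (Tag 0F3W applied to the proper `p₁`, an isomorphism over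
`N₁ ⊇ Z₁,₂`; the new `X₁₂` is the strict transform of the old one by Tag 0F3Y). Unconditional form of
`exists_isIso_near` (same proof, with `stacks0F3W`). [cite: StacksProject, Tag 0F40 (proof)] -/
theorem exists_isIso_near_closure (hcov : U₁ ⊔ U₂ = ⊤) (hV₁ : IsCompact (E₁.V : Set E₁.X)) :
    ∃ (X₁' : Scheme.{u}) (b : X₁' ⟶ E₁.X) (Q : E₁.X.IdealSheafData) (hb : IsBlowup b Q)
      (hQfg : ∀ W : E₁.X.affineOpens, (Q.ideal W).FG) (hQV : Disjoint (E₁.V : Set E₁.X) (Q.support : Set E₁.X))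
      (N' : X₁'.Opens),
      closure ((E₁.blowup b hb hQfg hQV).locus (U₁ : Set U)ᶜ : Set X₁') ⊆ (N' : Set X₁') ∧
        IsIso (p₁ (E₁.blowup b hb hQfg hQV) E₂ ∣_ N') := by
  haveI := isIso_p₁_restrict E₁ E₂ (U₂ := U₂)
  -- Tag 0F3W for `p₁`, `V = V₁`, `T = Z₁,₂`, `N = N₁`
  have hTN : E₁.locus (U₁ : Set U)ᶜ ⊆ (N₁ E₁ (U₂ := U₂) : Set E₁.X) := by
    rw [coe_N₁]
    rintro _ ⟨v, hv, rfl⟩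
    refine ⟨v, ?_, rfl⟩
    have : E₁.ψ v ∈ ((U₁ ⊔ U₂ : U.Opens) : Set U) := by rw [hcov]; trivial
    rcases this with h | h
    · exact (hv h).elim
    · exact h
  obtain ⟨Q, X₁', b, N', hQfg, hQsupp, hb, hcl, hiso⟩ := stacks0F3W (p₁ E₁ E₂) E₁.V hV₁
    (E₁.locus (U₁ : Set U)ᶜ) (E₁.locus_subset _) (E₁.closure_locus_inter _ U₁.2.isClosed_compl)
    (N₁ E₁) (by rintro _ ⟨v, -, rfl⟩; exact v.2) hTN
  have hQV : Disjoint (E₁.V : Set E₁.X) (Q.support : Set E₁.X) := by rw [hQsupp]; exact disjoint_compl_right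
  refine ⟨X₁', b, Q, hb, hQfg, hQV, N', ?_, ?_⟩
  · rw [E₁.blowup_locus]; exact hcl
  · /- Tag 0F3Y: the new `X₁₂` is the strict transform -/
    have hcc : centreCompl Q = E₁.V := centreCompl_eq_of_support_eq hQsupp
    haveI : IsIso (b ∣_ centreCompl Q) := by rw [hcc]; exact hb.isIso_morphismRestrict hQV
    haveI : QuasiCompact (centreCompl Q).ι := by
      rw [hcc]
      exact Limits.quasiCompact_ι_of_isCompact E₁.V hV₁
    set v := pairMap E₁ E₂ with hvdef
    have hv : Set.range (v ≫ pullback.fst E₁.πX E₂.πX) ⊆ (centreCompl Q : Set E₁.X) := by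
      rw [hcc, hvdef, pairMap_fst]
      rintro _ ⟨x, rfl⟩
      exact (pullback.fst E₁.ψ E₂.ψ x).2
    set L := liftToProduct E₁.πX E₂.πX b Q v hv with hL
    -- the comparison `κ : V₁' ×_U V₂ ≅ V₁ ×_U V₂`
    set E₁' := E₁.blowup b hb hQfg hQV with hE₁'
    haveI := E₁.isIso_restrict_of_blowup b hb hQV
    set κ : pullback E₁'.ψ E₂.ψ ⟶ pullback E₁.ψ E₂.ψ :=
      pullback.map E₁'.ψ E₂.ψ E₁.ψ E₂.ψ (b ∣_ E₁.V) (𝟙 _) (𝟙 U) (by rw [Category.comp_id]; rfl)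
        (by rw [Category.comp_id, Category.id_comp]) with hκ
    haveI : IsIso κ := by rw [hκ]; infer_instance
    -- `pairMap E₁' E₂ = κ ≫ L`
    have hκfst : κ ≫ pullback.fst E₁.ψ E₂.ψ = pullback.fst E₁'.ψ E₂.ψ ≫ (b ∣_ E₁.V) := by
      rw [hκ, pullback.lift_fst]
    have hκsnd : κ ≫ pullback.snd E₁.ψ E₂.ψ = pullback.snd E₁'.ψ E₂.ψ := by
      rw [hκ, pullback.lift_snd, Category.comp_id]
    -- components (definitional unfoldings of the blown-up data)
    have h1 : pairMap E₁' E₂ ≫ pullback.fst E₁'.πX E₂.πX = pullback.fst E₁'.ψ E₂.ψ ≫ (b ⁻¹ᵁ E₁.V).ι :=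
      pairMap_fst E₁' E₂
    have h2 : pairMap E₁' E₂ ≫ pullback.snd E₁'.πX E₂.πX = pullback.snd E₁'.ψ E₂.ψ ≫ E₂.V.ι :=
      pairMap_snd E₁' E₂
    have h3 : (κ ≫ L) ≫ pullback.fst E₁'.πX E₂.πX = κ ≫ liftToBlowup E₁.πX E₂.πX b Q v hv := by
      rw [Category.assoc]
      exact congrArg (κ ≫ ·) (liftToProduct_fst E₁.πX E₂.πX b Q v hv)
    have h4 : (κ ≫ L) ≫ pullback.snd E₁'.πX E₂.πX = κ ≫ v ≫ pullback.snd E₁.πX E₂.πX := by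
      rw [Category.assoc]
      exact congrArg (κ ≫ ·) (liftToProduct_snd E₁.πX E₂.πX b Q v hv)
    have hmap : pairMap E₁' E₂ = κ ≫ L := by
      apply pullback.hom_ext
      · -- both first components lift `fst ≫ (b|V₁) ≫ V₁.ι` along `b`, over `V₁`
        refine Literature.AlgebraicGeometry.Resolution.ext_of_isIso_morphismRestrict b (centreCompl Q) ?_ ?_
        · rw [h1, h3, Category.assoc, Category.assoc, liftToBlowup_comp, hvdef, pairMap_fst,
            ← Category.assoc κ, hκfst, Category.assoc, ← morphismRestrict_ι]
        · rw [h1, hcc]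
          rintro _ ⟨x, rfl⟩
          exact (pullback.fst E₁'.ψ E₂.ψ x).2
      · rw [h2, h4, hvdef, pairMap_snd, ← Category.assoc κ, hκsnd]
    -- transport `IsIso` along the identifications of images
    obtain ⟨e₁, he₁⟩ := exists_image_iso_of_eq hmap
    obtain ⟨e₂, he₂⟩ := exists_image_iso_of_isIso_comp κ L
    have key : p₁ E₁' E₂ = (e₁.hom ≫ e₂.hom ≫ imageLiftToStrictTransform E₁.πX E₂.πX b Q v hv) ≫
        blowupStrictTransformMap (p₁ E₁ E₂) b Q := by
      have h5 : L.imageι ≫ pullback.fst E₁'.πX E₂.πX = imageLiftToStrictTransform E₁.πX E₂.πX b Q v hv ≫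
          blowupStrictTransformMap (v.imageι ≫ pullback.fst E₁.πX E₂.πX) b Q :=
        imageι_fst_eq E₁.πX E₂.πX b Q v hv
      rw [p₁, ← he₁, Category.assoc, ← he₂, Category.assoc, Category.assoc, Category.assoc, h5]
      rfl
    rw [key]
    haveI : IsIso ((e₁.hom ≫ e₂.hom ≫ imageLiftToStrictTransform E₁.πX E₂.πX b Q v hv) ∣_
        (blowupStrictTransformMap (p₁ E₁ E₂) b Q) ⁻¹ᵁ N') :=
      (MorphismProperty.isomorphisms.iff _).mp
        (IsZariskiLocalAtTarget.restrict ((MorphismProperty.isomorphisms.iff _).mpr inferInstance) _)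
    haveI := hiso
    exact isIso_morphismRestrict_comp _ _ N'


end Near

section GoodPair

variable [CompactSpace S] [QuasiSeparatedSpace S]

/-- **The output of the two reductions of the proof of Tag 0F40**: starting from any extension
data for `U₁, U₂` (with `Vᵢ` quasi-compact, e.g. everything Noetherian) one obtains, by admissible
blowing ups, extension data `F₁, F₂` with `X₁₂ ∩ (Z̄₁,₂ ×_S Z̄₂,₁) = ∅`. Unconditional form of
`exists_goodPair`. [cite: StacksProject, Tag 0F40 (proof)] -/
theorem exists_goodPair_of_extData (hcov : U₁ ⊔ U₂ = ⊤) (hU₁ : IsCompact (U₁ : Set U))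
    (hU₂ : IsCompact (U₂ : Set U)) (E₁ : ExtData g U₁) (E₂ : ExtData g U₂)
    (hV : ∀ (Ui : U.Opens) (E : ExtData g Ui), IsCompact (E.V : Set E.X)) :
    ∃ (F₁ : ExtData g U₁) (F₂ : ExtData g U₂), ∀ z : (pairMap F₁ F₂).image,
      p₁ F₁ F₂ z ∈ closure (F₁.locus (U₁ : Set U)ᶜ) → p₂ F₁ F₂ z ∉ closure (F₂.locus (U₂ : Set U)ᶜ) := by
  haveI := compactSpace_X (U₁ := U₂) E₂
  haveI := quasiSeparatedSpace_X (U₁ := U₂) E₂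
  -- separate on `X₂`
  obtain ⟨X₂', β, C, hβ, hCfg, hCV, hsep₂⟩ := E₂.exists_separating (Uj := U₁) (by rw [sup_comm, hcov]) hU₂ hU₁
  set F₂ := E₂.blowup β hβ hCfg hCV with hF₂
  haveI := compactSpace_X E₁
  haveI := quasiSeparatedSpace_X E₁
  haveI := quasiSeparatedSpace_X (U₁ := U₂) F₂
  haveI : CompactSpace (F₂.V : Scheme.{u}) := isCompact_iff_compactSpace.mp (hV U₂ F₂)
  haveI : CompactSpace (pullback E₁.ψ F₂.ψ : Scheme.{u}) :=
    QuasiCompact.compactSpace_of_compactSpace (pullback.snd E₁.ψ F₂.ψ)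
  -- make `p₁` an isomorphism near `Z̄₁,₂`
  obtain ⟨X₁', b, Q, hb, hQfg, hQV, N', hN', hiso⟩ := exists_isIso_near_closure E₁ F₂ hcov (hV U₁ E₁)
  haveI := hiso
  exact ⟨E₁.blowup b hb hQfg hQV, F₂, fun z hz => pair_empty _ F₂ hcov N' hN' hsep₂ z hz⟩


end GoodPair

end ExtData

/-! ### Stacks 0F40 -/

section TwoPiece

variable {U S : Scheme.{u}} [IsNoetherian S] (g : U ⟶ S) [IsSeparated g] [LocallyOfFiniteType g]
  [QuasiCompact g] (U₁ U₂ : U.Opens)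

/-- **Stacks 0F40 (the two-piece compactification lemma).** Let `S` be Noetherian, `g : U → S`
separated of finite type,
`U = U₁ ∪ U₂` opens with `U₁ ∩ U₂` dense in `U`, and assume `U₁ → S` and `U₂ → S` have
compactifications. Then `U → S` has a compactification. Unconditional form of
`exists_compactification_of_twoPiece_of_stacks081R` (same proof). [cite: StacksProject, Tag 0F40] -/
theorem exists_compactification_of_twoPiece (hcov : U₁ ⊔ U₂ = ⊤)
    (hdense : Dense ((U₁ ⊓ U₂ : U.Opens) : Set U))
    (h₁ : ∃ (Y : Scheme.{u}) (j : (U₁ : Scheme.{u}) ⟶ Y) (π : Y ⟶ S),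
      IsOpenImmersion j ∧ IsProper π ∧ j ≫ π = U₁.ι ≫ g)
    (h₂ : ∃ (Y : Scheme.{u}) (j : (U₂ : Scheme.{u}) ⟶ Y) (π : Y ⟶ S),
      IsOpenImmersion j ∧ IsProper π ∧ j ≫ π = U₂.ι ≫ g) :
    ∃ (Y : Scheme.{u}) (j : U ⟶ Y) (π : Y ⟶ S), IsOpenImmersion j ∧ IsProper π ∧ j ≫ π = g := by
  haveI : IsNoetherian U := isNoetherian_of_locallyOfFiniteType g
  have hU₁ : IsCompact (U₁ : Set U) := NoetherianSpace.isCompact _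
  have hU₂ : IsCompact (U₂ : Set U) := NoetherianSpace.isCompact _
  /- Step 1: extension data (Tag 0F3Z) and the two reductions (Tags 0F3V, 0F3W, 0F3Y) -/
  obtain ⟨E₁⟩ := ExtData.nonempty_of_exists_compactification g U₁ hU₁ h₁
  obtain ⟨E₂⟩ := ExtData.nonempty_of_exists_compactification g U₂ hU₂ h₂
  have hV : ∀ (Ui : U.Opens) (E : ExtData g Ui), IsCompact (E.V : Set E.X) := fun Ui E => by
    haveI : IsNoetherian E.X := isNoetherian_of_locallyOfFiniteType E.πX
    exact NoetherianSpace.isCompact _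
  obtain ⟨F₁, F₂, hempty⟩ := ExtData.exists_goodPair_of_extData (g := g) hcov hU₁ hU₂ E₁ E₂ hV
  haveI : IsNoetherian F₁.X := isNoetherian_of_locallyOfFiniteType F₁.πX
  haveI : IsNoetherian F₂.X := isNoetherian_of_locallyOfFiniteType F₂.πX
  /- Step 2: the pieces `Wᵢ = U ⨿_{Uᵢ} Xᵢ°` (Tag 0F3U), separated and of finite type over `S` -/
  haveI : CompactSpace (F₁.core : Scheme.{u}) := isCompact_iff_compactSpace.mp (NoetherianSpace.isCompact _)
  haveI : CompactSpace (F₂.core : Scheme.{u}) := isCompact_iff_compactSpace.mp (NoetherianSpace.isCompact _)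
  haveI : QuasiCompact F₁.pieceDesc := Limits.quasiCompact_pushoutDesc _ _ _ _ _
  haveI : QuasiCompact F₂.pieceDesc := Limits.quasiCompact_pushoutDesc _ _ _ _ _
  haveI : QuasiCompact (pushout.inl U₁.ι F₁.jCore) := by
    haveI : QuasiSeparatedSpace F₁.piece := quasiSeparatedSpace_of_quasiSeparated F₁.pieceDesc
    infer_instance
  /- Step 3: Tag 0F3X for `U ⊆ W₁, W₂` -/
  obtain ⟨D⟩ := stacks0F3X F₁.pieceDesc F₂.pieceDesc (pushout.inl U₁.ι F₁.jCore)
    (pushout.inl U₂.ι F₂.jCore) (by rw [ExtData.inl_pieceDesc, ExtData.inl_pieceDesc])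
  haveI := D.isOpenImmersion₁
  haveI := D.isOpenImmersion₂
  haveI := D.isSeparated
  haveI := D.locallyOfFiniteType
  haveI := D.quasiCompact
  haveI := D.isOpenImmersion_u₁'
  haveI := D.isOpenImmersion_u₂'
  haveI : IsProper D.b₁ := IsBlowup.isProper_of_fg D.fg₁ D.isBlowup₁
  haveI : IsProper D.b₂ := IsBlowup.isProper_of_fg D.fg₂ D.isBlowup₂
  -- the structure morphisms: `uᵢ' ≫ iᵢ ≫ g_X = g`
  have hg₁ : D.u₁' ≫ D.i₁ ≫ D.g = g := by
    rw [D.i₁_g, ← Category.assoc, D.u₁'_b₁, ExtData.inl_pieceDesc]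
  have hg₂ : D.u₂' ≫ D.i₂ ≫ D.g = g := by
    rw [D.i₂_g, ← Category.assoc, D.u₂'_b₂, ExtData.inl_pieceDesc]
  /- Step 4: `U₁ ∩ U₂ → X` has dense image (all blowing ups are normalised) -/
  set h : ((U₁ ⊓ U₂ : U.Opens) : Scheme.{u}) ⟶ D.X := (U₁ ⊓ U₂).ι ≫ D.u₁' ≫ D.i₁ with hh
  haveI : CompactSpace D.X := QuasiCompact.compactSpace_of_compactSpace D.g
  haveI : QuasiSeparatedSpace D.X := quasiSeparatedSpace_of_quasiSeparated D.g
  haveI : CompactSpace ((U₁ ⊓ U₂ : U.Opens) : Scheme.{u}) :=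
    isCompact_iff_compactSpace.mp (NoetherianSpace.isCompact _)
  haveI : QuasiCompact h := inferInstance
  -- `uᵢ'(U)` is dense in `Xᵢ'`
  have hrange : ∀ {W W' : Scheme.{u}} (u : U ⟶ W) [IsOpenImmersion u] (u' : U ⟶ W') (b : W' ⟶ W)
      (Q : W.IdealSheafData), u' ≫ b = u → IsBlowup b Q → (Q.support : Set W) = (Set.range u)ᶜ →
      Dense (Set.range u') := by
    intro W W' u _ u' b Q hu'b hb hQ
    have hQ' : (Q.support : Set W) = ((u.opensRange : W.Opens) : Set W)ᶜ := by rw [hQ, Scheme.Hom.coe_opensRange]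
    obtain ⟨hqc, hsd⟩ := hb.quasiCompact_and_isSchemeTheoreticallyDominant_ι_preimage hQ'
    haveI := hqc
    haveI := hsd
    haveI : IsIso (b ∣_ u.opensRange) := hb.isIso_morphismRestrict_of_support_eq hQ'
    have hr : Set.range u' = ((b ⁻¹ᵁ u.opensRange : W'.Opens) : Set W') := by
      apply Set.Subset.antisymm
      · rintro _ ⟨x, rfl⟩
        show b (u' x) ∈ u.opensRange
        rw [← Scheme.Hom.comp_apply, hu'b]
        exact ⟨x, rfl⟩
      · intro x' hx'
        obtain ⟨x, hx⟩ := (id hx' : b x' ∈ Set.range u)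
        have h1 : b (u' x) = b x' := by rw [← Scheme.Hom.comp_apply, hu'b]; exact hx
        have h2 := (ConcreteCategory.bijective_of_isIso (b ∣_ u.opensRange).base).1
          (a₁ := ⟨u' x, show b (u' x) ∈ u.opensRange from h1 ▸ hx'⟩) (a₂ := ⟨x', hx'⟩)
          (Subtype.ext (by rw [morphismRestrict_base_coe, morphismRestrict_base_coe]; exact h1))
        exact ⟨x, congrArg Subtype.val h2⟩
    rw [hr, ← Scheme.Opens.range_ι]
    exact (b ⁻¹ᵁ u.opensRange).ι.denseRange
  have hd₁ : Dense (Set.range D.u₁') := hrange _ D.u₁' D.b₁ D.Q₁ D.u₁'_b₁ D.isBlowup₁ D.supp₁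
  have hd₂ : Dense (Set.range D.u₂') := hrange _ D.u₂' D.b₂ D.Q₂ D.u₂'_b₂ D.isBlowup₂ D.supp₂
  have hdU : DenseRange (D.u₁' ≫ D.i₁) := by
    rw [DenseRange, dense_iff_closure_eq, Set.eq_univ_iff_forall]
    intro x
    have hx : x ∈ Set.range D.i₁ ∪ Set.range D.i₂ := by rw [D.range_i₁_union_range_i₂]; trivial
    rcases hx with ⟨y, rfl⟩ | ⟨y, rfl⟩
    · have h1 : D.i₁ y ∈ D.i₁ '' closure (Set.range D.u₁') := ⟨y, by rw [hd₁.closure_eq]; trivial, rfl⟩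
      refine closure_mono ?_ (image_closure_subset_closure_image D.i₁.continuous h1)
      rintro _ ⟨_, ⟨t, rfl⟩, rfl⟩
      exact ⟨t, Scheme.Hom.comp_apply _ _ t⟩
    · have h1 : D.i₂ y ∈ D.i₂ '' closure (Set.range D.u₂') := ⟨y, by rw [hd₂.closure_eq]; trivial, rfl⟩
      refine closure_mono ?_ (image_closure_subset_closure_image D.i₂.continuous h1)
      rintro _ ⟨_, ⟨t, rfl⟩, rfl⟩
      refine ⟨t, ?_⟩
      rw [D.u₁'_i₁]
      exact Scheme.Hom.comp_apply _ _ t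
  have hdh : DenseRange h := by
    have e : Set.range h = (D.u₁' ≫ D.i₁) '' ((U₁ ⊓ U₂ : U.Opens) : Set U) := by
      rw [hh, Scheme.Hom.comp_base, TopCat.coe_comp, Set.range_comp, Scheme.Opens.range_ι]
    rw [DenseRange, e]
    exact hdU.dense_image (D.u₁' ≫ D.i₁).continuous hdense
  /- Step 5: the valuative lifts and properness of `X → S` (Tag 0894) -/
  have hproper : IsProper D.g := by
    refine isProper_of_valuativeCriterion_comp_of_denseRange h D.g hdh ?_
    intro A K _ _ _ _ _ _ uK sA hsq
    -- the `K`-point of `Uᵢ` and its extension `gᵢ : Spec A → Xᵢ` (valuative criterion for `Xᵢ → S`)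
    obtain ⟨uK₁, huK₁⟩ : ∃ u : Spec (.of K) ⟶ U₁, u = uK ≫ U.homOfLE inf_le_left := ⟨_, rfl⟩
    obtain ⟨uK₂, huK₂⟩ : ∃ u : Spec (.of K) ⟶ U₂, u = uK ≫ U.homOfLE inf_le_right := ⟨_, rfl⟩
    have huK₁' : uK₁ ≫ U₁.ι = uK ≫ (U₁ ⊓ U₂).ι := by rw [huK₁, Category.assoc, Scheme.homOfLE_ι]
    have huK₂' : uK₂ ≫ U₂.ι = uK ≫ (U₁ ⊓ U₂).ι := by rw [huK₂, Category.assoc, Scheme.homOfLE_ι]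
    have hsq' : uK ≫ (U₁ ⊓ U₂).ι ≫ g = Spec.map (CommRingCat.ofHom (algebraMap A K)) ≫ sA := by
      rw [← hsq, hh, Category.assoc, Category.assoc, hg₁]
    obtain ⟨l₁, hl₁K, hl₁A⟩ := exists_lift_of_universallyClosed F₁.πX (uK₁ ≫ F₁.jX) sA
      (by rw [Category.assoc, F₁.jX_πX, ← Category.assoc, huK₁', Category.assoc, hsq'])
    obtain ⟨l₂, hl₂K, hl₂A⟩ := exists_lift_of_universallyClosed F₂.πX (uK₂ ≫ F₂.jX) sA
      (by rw [Category.assoc, F₂.jX_πX, ← Category.assoc, huK₂', Category.assoc, hsq'])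
    -- the generic lift through `Wᵢ`, given that `lᵢ` lands in `Xᵢ°`
    have lift_through : ∀ (i : Bool), (cond i (l₁ (IsLocalRing.closedPoint A) ∈ F₁.core)
        (l₂ (IsLocalRing.closedPoint A) ∈ F₂.core)) →
        ∃ l : Spec (.of A) ⟶ D.X, Spec.map (CommRingCat.ofHom (algebraMap A K)) ≫ l = uK ≫ h ∧ l ≫ D.g = sA := by
      intro i hi
      cases i with
      | true =>
        -- `l₁` factors through `X₁°`, giving `Spec A → W₁`; lift along the proper `b₁ : W₁' → W₁`
        have hr := range_subset_of_closedPoint_mem l₁ F₁.core hi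
        set l₁' := IsOpenImmersion.lift F₁.core.ι l₁ (by rwa [Scheme.Opens.range_ι]) with hl₁'
        have hl₁'ι : l₁' ≫ F₁.core.ι = l₁ := IsOpenImmersion.lift_fac _ _ _
        have hK : Spec.map (CommRingCat.ofHom (algebraMap A K)) ≫ l₁' = uK₁ ≫ F₁.jCore := by
          rw [← cancel_mono F₁.core.ι, Category.assoc, hl₁'ι, hl₁K]
          simp only [Category.assoc, ExtData.jCore_ι]
        obtain ⟨m, hmK, hmA⟩ := exists_lift_of_universallyClosed D.b₁ (uK ≫ (U₁ ⊓ U₂).ι ≫ D.u₁')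
          (l₁' ≫ pushout.inr U₁.ι F₁.jCore) (by
            rw [Category.assoc, Category.assoc, D.u₁'_b₁, ← Category.assoc, ← huK₁', Category.assoc,
              pushout.condition, ← Category.assoc, ← hK, Category.assoc])
        refine ⟨m ≫ D.i₁, ?_, ?_⟩
        · rw [← Category.assoc, hmK, hh]
          simp only [Category.assoc]
        · rw [Category.assoc, D.i₁_g, ← Category.assoc, hmA, Category.assoc, ExtData.inr_pieceDesc,
            ← Category.assoc, hl₁'ι, hl₁A]
      | false =>
        have hr := range_subset_of_closedPoint_mem l₂ F₂.core hi
        set l₂' := IsOpenImmersion.lift F₂.core.ι l₂ (by rwa [Scheme.Opens.range_ι]) with hl₂'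
        have hl₂'ι : l₂' ≫ F₂.core.ι = l₂ := IsOpenImmersion.lift_fac _ _ _
        have hK : Spec.map (CommRingCat.ofHom (algebraMap A K)) ≫ l₂' = uK₂ ≫ F₂.jCore := by
          rw [← cancel_mono F₂.core.ι, Category.assoc, hl₂'ι, hl₂K]
          simp only [Category.assoc, ExtData.jCore_ι]
        obtain ⟨m, hmK, hmA⟩ := exists_lift_of_universallyClosed D.b₂ (uK ≫ (U₁ ⊓ U₂).ι ≫ D.u₂')
          (l₂' ≫ pushout.inr U₂.ι F₂.jCore) (by
            rw [Category.assoc, Category.assoc, D.u₂'_b₂, ← Category.assoc, ← huK₂', Category.assoc,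
              pushout.condition, ← Category.assoc, ← hK, Category.assoc])
        refine ⟨m ≫ D.i₂, ?_, ?_⟩
        · rw [← Category.assoc, hmK, hh, D.u₁'_i₁]
          simp only [Category.assoc]
        · rw [Category.assoc, D.i₂_g, ← Category.assoc, hmA, Category.assoc, ExtData.inr_pieceDesc,
            ← Category.assoc, hl₂'ι, hl₂A]
    by_cases hc₁ : l₁ (IsLocalRing.closedPoint A) ∈ F₁.core
    · exact lift_through true hc₁
    by_cases hc₂ : l₂ (IsLocalRing.closedPoint A) ∈ F₂.core
    · exact lift_through false hc₂
    -- both closed points in `Z̄₁,₂` resp. `Z̄₂,₁`: contradiction with `X₁₂ ∩ (Z̄₁,₂ ×_S Z̄₂,₁) = ∅`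
    exfalso
    rw [ExtData.mem_core_iff, not_not] at hc₁ hc₂
    -- the pair `(l₁, l₂) : Spec A → X₁ ×_S X₂` and its generic point in `V₁₂`
    set G : Spec (.of A) ⟶ pullback F₁.πX F₂.πX := pullback.lift l₁ l₂ (by rw [hl₁A, hl₂A]) with hG
    set vK : Spec (.of K) ⟶ pullback F₁.ψ F₂.ψ := pullback.lift (uK₁ ≫ F₁.sV) (uK₂ ≫ F₂.sV) (by
      simp only [Category.assoc, F₁.sV_ψ, F₂.sV_ψ, huK₁', huK₂']) with hvK
    have hgen : Spec.map (CommRingCat.ofHom (algebraMap A K)) ≫ G = vK ≫ ExtData.pairMap F₁ F₂ := by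
      apply pullback.hom_ext
      · rw [Category.assoc, hG, pullback.lift_fst, hl₁K, Category.assoc, ExtData.pairMap_fst, hvK,
          pullback.lift_fst_assoc, Category.assoc, F₁.sV_ι]
      · rw [Category.assoc, hG, pullback.lift_snd, hl₂K, Category.assoc, ExtData.pairMap_snd, hvK,
          pullback.lift_snd_assoc, Category.assoc, F₂.sV_ι]
    -- the closed point of `Spec A` maps into `X₁₂`
    have hmem : G (IsLocalRing.closedPoint A) ∈ Set.range (ExtData.pairMap F₁ F₂).imageι := by
      have h0 : G (Spec.map (CommRingCat.ofHom (algebraMap A K)) (IsLocalRing.closedPoint K)) ∈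
          Set.range (ExtData.pairMap F₁ F₂).imageι := by
        rw [← Scheme.Hom.comp_apply, hgen, Scheme.Hom.comp_apply]
        exact ⟨(ExtData.pairMap F₁ F₂).toImage (vK (IsLocalRing.closedPoint K)), by
          rw [← Scheme.Hom.comp_apply, Scheme.Hom.toImage_imageι]⟩
      exact mem_range_of_specializes _ h0
        (((IsLocalRing.specializes_closedPoint _).map G.continuous))
    obtain ⟨z, hz⟩ := hmem
    refine hempty z ?_ ?_
    · show ((ExtData.pairMap F₁ F₂).imageι ≫ pullback.fst F₁.πX F₂.πX) z ∈ _
      rw [Scheme.Hom.comp_apply, hz, ← Scheme.Hom.comp_apply, hG, pullback.lift_fst]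
      exact hc₁
    · show ((ExtData.pairMap F₁ F₂).imageι ≫ pullback.snd F₁.πX F₂.πX) z ∈ _
      rw [Scheme.Hom.comp_apply, hz, ← Scheme.Hom.comp_apply, hG, pullback.lift_snd]
      exact hc₂
  exact ⟨D.X, D.u₁' ≫ D.i₁, D.g, inferInstance, hproper, by rw [Category.assoc, hg₁]⟩


end TwoPiece

/-- **Stacks 0F40 in the shape of the hypothesis `h0F40` of
`exists_compactification_of_isNoetherian_of_twoPiece`** (`NagataCompactification.lean`), over a
Noetherian base: for opens `W = W₁ ∪ W₂` of a Noetherian separated `S`-scheme `X` locally of finite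
type with `W₁ ∩ W₂` dense in `W` and `W₁, W₂` compactifiable over `S`, `W` is compactifiable over
`S`. Unconditional form of `h0F40_of_stacks081R`. [cite: StacksProject, Tag 0F40] -/
theorem stacks0F40 {X S : Scheme.{u}} [IsNoetherian S] [IsNoetherian X]
    (f : X ⟶ S) [IsSeparated f] [LocallyOfFiniteType f] (W W₁ W₂ : X.Opens) (hW : W₁ ⊔ W₂ = W)
    (hdense : Dense (W.ι ⁻¹' ((W₁ ⊓ W₂ : X.Opens) : Set X)))
    (h₁ : ∃ (Wc : Scheme.{u}) (j : (W₁ : Scheme.{u}) ⟶ Wc) (h : Wc ⟶ S),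
      IsOpenImmersion j ∧ IsProper h ∧ j ≫ h = W₁.ι ≫ f)
    (h₂ : ∃ (Wc : Scheme.{u}) (j : (W₂ : Scheme.{u}) ⟶ Wc) (h : Wc ⟶ S),
      IsOpenImmersion j ∧ IsProper h ∧ j ≫ h = W₂.ι ≫ f) :
    ∃ (Wc : Scheme.{u}) (j : (W : Scheme.{u}) ⟶ Wc) (h : Wc ⟶ S),
      IsOpenImmersion j ∧ IsProper h ∧ j ≫ h = W.ι ≫ f := by
  haveI : CompactSpace (W : Scheme.{u}) := isCompact_iff_compactSpace.mp (NoetherianSpace.isCompact _)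
  haveI : QuasiCompact (W.ι ≫ f) := inferInstance
  have hcov : W.ι ⁻¹ᵁ W₁ ⊔ W.ι ⁻¹ᵁ W₂ = ⊤ := by
    refine top_le_iff.mp fun x _ => ?_
    have hx : x.1 ∈ (W₁ ⊔ W₂ : X.Opens) := by rw [hW]; exact x.2
    rcases hx with h | h
    · exact Or.inl h
    · exact Or.inr h
  exact exists_compactification_of_twoPiece (W.ι ≫ f) (W.ι ⁻¹ᵁ W₁) (W.ι ⁻¹ᵁ W₂) hcov
    hdense (exists_compactification_preimage f W W₁ h₁) (exists_compactification_preimage f W W₂ h₂)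


/-! ### Compactifiability is Zariski-local on the base -/

/-- **Compactifications glue along the base after admissible blowing up** (see the module
docstring). Let `S` be quasi-compact and quasi-separated, `f : X → S` quasi-compact, and
`S = V ∪ W` with `V, W` quasi-compact opens. If `f|_V : f⁻¹V → V` and `f|_W : f⁻¹W → W` both
factor as an open immersion followed by a proper morphism, then so does `f`. Through the common
admissible blowing up of two compactifications (Conrad 2007, Remark 2.12); unconditional form of
`exists_compactification_of_iSup_eq_top₂` (same proof). [cite: Conrad2007, Remark 2.12 and §4] -/
theorem exists_compactification_of_sup_eq_top {X S : Scheme.{u}}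
    [QuasiSeparatedSpace S] (f : X ⟶ S) [QuasiCompact f]
    (V W : S.Opens) (hV : IsCompact (V : Set S)) (hW : IsCompact (W : Set S)) (hVW : V ⊔ W = ⊤)
    (h₁ : ∃ (Y : Scheme.{u}) (j : ↑(f ⁻¹ᵁ V) ⟶ Y) (q : Y ⟶ V),
      IsOpenImmersion j ∧ IsProper q ∧ j ≫ q = f ∣_ V)
    (h₂ : ∃ (Y : Scheme.{u}) (j : ↑(f ⁻¹ᵁ W) ⟶ Y) (q : Y ⟶ W),
      IsOpenImmersion j ∧ IsProper q ∧ j ≫ q = f ∣_ W) :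
    ∃ (Y : Scheme.{u}) (j : X ⟶ Y) (q : Y ⟶ S), IsOpenImmersion j ∧ IsProper q ∧ j ≫ q = f := by
  obtain ⟨Y₁, j₁, q₁, hj₁, hq₁, hjq₁⟩ := h₁
  obtain ⟨Y₂, j₂, q₂, hj₂, hq₂, hjq₂⟩ := h₂
  haveI := hj₁
  haveI := hj₂
  haveI := hq₁
  haveI := hq₂
  /- the structure morphisms `πᵢ : Yᵢ → S` -/
  obtain ⟨π₁, hπ₁, hπ₁V⟩ : ∃ π₁ : Y₁ ⟶ S, π₁ = q₁ ≫ V.ι ∧ ∀ y, π₁ y ∈ V :=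
    ⟨q₁ ≫ V.ι, rfl, fun y => (q₁ y).2⟩
  obtain ⟨π₂, hπ₂, hπ₂W⟩ : ∃ π₂ : Y₂ ⟶ S, π₂ = q₂ ≫ W.ι ∧ ∀ y, π₂ y ∈ W :=
    ⟨q₂ ≫ W.ι, rfl, fun y => (q₂ y).2⟩
  have hjπ₁ : j₁ ≫ π₁ = (f ⁻¹ᵁ V).ι ≫ f := by rw [hπ₁, reassoc_of% hjq₁, morphismRestrict_ι]
  have hjπ₂ : j₂ ≫ π₂ = (f ⁻¹ᵁ W).ι ≫ f := by rw [hπ₂, reassoc_of% hjq₂, morphismRestrict_ι]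
  haveI : IsSeparated π₁ := by rw [hπ₁]; infer_instance
  haveI : IsSeparated π₂ := by rw [hπ₂]; infer_instance
  /- topological bookkeeping -/
  haveI : CompactSpace V := isCompact_iff_compactSpace.mp hV
  haveI : CompactSpace W := isCompact_iff_compactSpace.mp hW
  haveI : QuasiSeparatedSpace V := QuasiSeparatedSpace.of_isOpenEmbedding V.ι.isOpenEmbedding
  haveI : QuasiSeparatedSpace W := QuasiSeparatedSpace.of_isOpenEmbedding W.ι.isOpenEmbedding
  haveI : CompactSpace ↑(f ⁻¹ᵁ V) := isCompact_iff_compactSpace.mp (f.isCompact_preimage hV)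
  haveI : CompactSpace ↑(f ⁻¹ᵁ W) := isCompact_iff_compactSpace.mp (f.isCompact_preimage hW)
  haveI : CompactSpace Y₁ := QuasiCompact.compactSpace_of_compactSpace q₁
  haveI : CompactSpace Y₂ := QuasiCompact.compactSpace_of_compactSpace q₂
  haveI : QuasiSeparatedSpace Y₁ := quasiSeparatedSpace_of_quasiSeparated q₁
  haveI : QuasiSeparatedSpace Y₂ := quasiSeparatedSpace_of_quasiSeparated q₂
  haveI : QuasiCompact π₁ := by rw [hπ₁]; infer_instance
  haveI : QuasiCompact π₂ := by rw [hπ₂]; infer_instance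
  /- `πᵢ` is proper over `V` (resp. `W`): `πᵢ|_V ≅ qᵢ` -/
  have hpbq₁ : IsPullback q₁ (𝟙 Y₁) V.ι π₁ :=
    IsOpenImmersion.isPullback q₁ (𝟙 Y₁) V.ι π₁ (by rw [Category.id_comp, hπ₁]) (by
      rw [Scheme.Opens.opensRange_ι, Scheme.Hom.opensRange_of_isIso]
      exact Opens.ext (Set.eq_univ_of_forall fun y => hπ₁V y))
  have hpbq₂ : IsPullback q₂ (𝟙 Y₂) W.ι π₂ :=
    IsOpenImmersion.isPullback q₂ (𝟙 Y₂) W.ι π₂ (by rw [Category.id_comp, hπ₂]) (by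
      rw [Scheme.Opens.opensRange_ι, Scheme.Hom.opensRange_of_isIso]
      exact Opens.ext (Set.eq_univ_of_forall fun y => hπ₂W y))
  haveI : IsProper (π₁ ∣_ V) := by
    rw [← (isPullback_morphismRestrict π₁ V).isoIsPullback_hom_fst _ _ hpbq₁]
    infer_instance
  haveI : IsProper (π₂ ∣_ W) := by
    rw [← (isPullback_morphismRestrict π₂ W).isoIsPullback_hom_fst _ _ hpbq₂]
    infer_instance
  /- the overlap `B = V ∩ W` and the pieces over it -/
  obtain ⟨B, hB⟩ : ∃ B : S.Opens, B = V ⊓ W := ⟨_, rfl⟩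
  have hBV : B ≤ V := hB ▸ inf_le_left
  have hBW : B ≤ W := hB ▸ inf_le_right
  have hBc : IsCompact (B : Set S) := by
    rw [hB, Opens.coe_inf]
    exact hV.inter_of_isOpen hW V.2 W.2
  haveI : CompactSpace B := isCompact_iff_compactSpace.mp hBc
  haveI : QuasiSeparatedSpace B := QuasiSeparatedSpace.of_isOpenEmbedding B.ι.isOpenEmbedding
  haveI : CompactSpace ↑(f ⁻¹ᵁ B) := isCompact_iff_compactSpace.mp (f.isCompact_preimage hBc)
  haveI : IsProper (π₁ ∣_ B) := of_morphismRestrict_of_le (P := @IsProper) π₁ hBV inferInstance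
  haveI : IsProper (π₂ ∣_ B) := of_morphismRestrict_of_le (P := @IsProper) π₂ hBW inferInstance
  have hle₁ : f ⁻¹ᵁ B ≤ f ⁻¹ᵁ V := fun x hx => hBV hx
  have hle₂ : f ⁻¹ᵁ B ≤ f ⁻¹ᵁ W := fun x hx => hBW hx
  -- `eᵢ : f⁻¹B → πᵢ⁻¹B`, the restriction of `jᵢ`
  have hr₁ : Set.range (X.homOfLE hle₁ ≫ j₁) ⊆ Set.range (π₁ ⁻¹ᵁ B).ι := by
    rw [Scheme.Opens.range_ι]
    rintro _ ⟨x, rfl⟩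
    show π₁ ((X.homOfLE hle₁ ≫ j₁) x) ∈ B
    rw [← Scheme.Hom.comp_apply, Category.assoc, hjπ₁, Scheme.homOfLE_ι_assoc,
      Scheme.Hom.comp_apply, Scheme.Opens.ι_apply]
    exact x.2
  have hr₂ : Set.range (X.homOfLE hle₂ ≫ j₂) ⊆ Set.range (π₂ ⁻¹ᵁ B).ι := by
    rw [Scheme.Opens.range_ι]
    rintro _ ⟨x, rfl⟩
    show π₂ ((X.homOfLE hle₂ ≫ j₂) x) ∈ B
    rw [← Scheme.Hom.comp_apply, Category.assoc, hjπ₂, Scheme.homOfLE_ι_assoc,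
      Scheme.Hom.comp_apply, Scheme.Opens.ι_apply]
    exact x.2
  obtain ⟨e₁, he₁ι, he₁o⟩ : ∃ e₁ : ↑(f ⁻¹ᵁ B) ⟶ ↑(π₁ ⁻¹ᵁ B),
      e₁ ≫ (π₁ ⁻¹ᵁ B).ι = X.homOfLE hle₁ ≫ j₁ ∧ IsOpenImmersion e₁ := by
    refine ⟨IsOpenImmersion.lift (π₁ ⁻¹ᵁ B).ι _ hr₁, IsOpenImmersion.lift_fac _ _ _, ?_⟩
    haveI : IsOpenImmersion (IsOpenImmersion.lift (π₁ ⁻¹ᵁ B).ι _ hr₁ ≫ (π₁ ⁻¹ᵁ B).ι) := by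
      rw [IsOpenImmersion.lift_fac]
      infer_instance
    exact IsOpenImmersion.of_comp _ (π₁ ⁻¹ᵁ B).ι
  obtain ⟨e₂, he₂ι, he₂o⟩ : ∃ e₂ : ↑(f ⁻¹ᵁ B) ⟶ ↑(π₂ ⁻¹ᵁ B),
      e₂ ≫ (π₂ ⁻¹ᵁ B).ι = X.homOfLE hle₂ ≫ j₂ ∧ IsOpenImmersion e₂ := by
    refine ⟨IsOpenImmersion.lift (π₂ ⁻¹ᵁ B).ι _ hr₂, IsOpenImmersion.lift_fac _ _ _, ?_⟩
    haveI : IsOpenImmersion (IsOpenImmersion.lift (π₂ ⁻¹ᵁ B).ι _ hr₂ ≫ (π₂ ⁻¹ᵁ B).ι) := by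
      rw [IsOpenImmersion.lift_fac]
      infer_instance
    exact IsOpenImmersion.of_comp _ (π₂ ⁻¹ᵁ B).ι
  haveI := he₁o
  haveI := he₂o
  have heq₁ : e₁ ≫ (π₁ ∣_ B) = f ∣_ B := by
    rw [← cancel_mono B.ι, Category.assoc, morphismRestrict_ι, reassoc_of% he₁ι, hjπ₁,
      Scheme.homOfLE_ι_assoc, morphismRestrict_ι]
  have heq₂ : e₂ ≫ (π₂ ∣_ B) = f ∣_ B := by
    rw [← cancel_mono B.ι, Category.assoc, morphismRestrict_ι, reassoc_of% he₂ι, hjπ₂,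
      Scheme.homOfLE_ι_assoc, morphismRestrict_ι]
  /- Step 1: a common admissible blowing up `T` of the two compactifications over `B` -/
  obtain ⟨T, e, t₁, t₂, K₁, K₂, he, het₁, het₂, ht, hK₁fg, hK₁U, hK₁, hK₂fg, hK₂U, hK₂⟩ :=
    exists_common_admissible_blowup e₁ (π₁ ∣_ B) e₂ (π₂ ∣_ B)
      (heq₁.trans heq₂.symm)
  haveI := he
  /- Step 2: extend the centres to `jᵢ(f⁻¹Vᵢ)`-admissible centres `Gᵢ` on `Yᵢ` -/
  have hcpt₁ : IsCompact ((π₁ ⁻¹ᵁ B : Y₁.Opens) : Set Y₁) := π₁.isCompact_preimage hBc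
  have hcpt₂ : IsCompact ((π₂ ⁻¹ᵁ B : Y₂.Opens) : Set Y₂) := π₂.isCompact_preimage hBc
  have hK₁U' : Disjoint (((π₁ ⁻¹ᵁ B).ι ⁻¹ᵁ j₁.opensRange : (↑(π₁ ⁻¹ᵁ B) : Scheme.{u}).Opens) :
      Set ↑(π₁ ⁻¹ᵁ B)) (K₁.support : Set ↑(π₁ ⁻¹ᵁ B)) := by
    refine Set.disjoint_left.mpr fun y hy hyK => Set.disjoint_left.mp hK₁U ?_ hyK
    obtain ⟨x, hx⟩ : (π₁ ⁻¹ᵁ B).ι y ∈ j₁.opensRange := hy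
    have hxB : x.1 ∈ f ⁻¹ᵁ B := by
      show f x.1 ∈ B
      have h1 : f x.1 = π₁ (j₁ x) := by
        rw [← Scheme.Opens.ι_apply, ← Scheme.Hom.comp_apply, ← hjπ₁, Scheme.Hom.comp_apply]
      rw [h1, hx]
      exact y.2
    have hx' : X.homOfLE hle₁ ⟨x.1, hxB⟩ = x := Subtype.ext (Scheme.homOfLE_apply hle₁ _)
    refine ⟨⟨x.1, hxB⟩, (π₁ ⁻¹ᵁ B).ι.isOpenEmbedding.injective ?_⟩
    rw [← Scheme.Hom.comp_apply, he₁ι, Scheme.Hom.comp_apply, hx', hx]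
  have hK₂U' : Disjoint (((π₂ ⁻¹ᵁ B).ι ⁻¹ᵁ j₂.opensRange : (↑(π₂ ⁻¹ᵁ B) : Scheme.{u}).Opens) :
      Set ↑(π₂ ⁻¹ᵁ B)) (K₂.support : Set ↑(π₂ ⁻¹ᵁ B)) := by
    refine Set.disjoint_left.mpr fun y hy hyK => Set.disjoint_left.mp hK₂U ?_ hyK
    obtain ⟨x, hx⟩ : (π₂ ⁻¹ᵁ B).ι y ∈ j₂.opensRange := hy
    have hxB : x.1 ∈ f ⁻¹ᵁ B := by
      show f x.1 ∈ B
      have h1 : f x.1 = π₂ (j₂ x) := by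
        rw [← Scheme.Opens.ι_apply, ← Scheme.Hom.comp_apply, ← hjπ₂, Scheme.Hom.comp_apply]
      rw [h1, hx]
      exact y.2
    have hx' : X.homOfLE hle₂ ⟨x.1, hxB⟩ = x := Subtype.ext (Scheme.homOfLE_apply hle₂ _)
    refine ⟨⟨x.1, hxB⟩, (π₂ ⁻¹ᵁ B).ι.isOpenEmbedding.injective ?_⟩
    rw [← Scheme.Hom.comp_apply, he₂ι, Scheme.Hom.comp_apply, hx', hx]
  obtain ⟨G₁, hG₁fg, hG₁K, hG₁U⟩ := exists_fg_comap_ι_eq_of_disjoint j₁.opensRange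
    (isCompact_range j₁.continuous) (π₁ ⁻¹ᵁ B) hcpt₁ K₁ hK₁fg hK₁U'
  obtain ⟨G₂, hG₂fg, hG₂K, hG₂U⟩ := exists_fg_comap_ι_eq_of_disjoint j₂.opensRange
    (isCompact_range j₂.continuous) (π₂ ⁻¹ᵁ B) hcpt₂ K₂ hK₂fg hK₂U'
  /- Step 3: blow up `Yᵢ` in `Gᵢ`; `jᵢ` lifts, and over `πᵢ⁻¹B` we recover `T` -/
  obtain ⟨Y₁', c₁, hc₁⟩ := exists_isBlowup Y₁ G₁
  obtain ⟨Y₂', c₂, hc₂⟩ := exists_isBlowup Y₂ G₂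
  haveI : IsProper c₁ := IsBlowup.isProper_of_fg hG₁fg hc₁
  haveI : IsProper c₂ := IsBlowup.isProper_of_fg hG₂fg hc₂
  haveI : IsIso (c₁ ∣_ j₁.opensRange) := hc₁.isIso_morphismRestrict hG₁U
  haveI : IsIso (c₂ ∣_ j₂.opensRange) := hc₂.isIso_morphismRestrict hG₂U
  obtain ⟨j₁', hj₁'c, hj₁'o⟩ : ∃ j₁' : ↑(f ⁻¹ᵁ V) ⟶ Y₁', j₁' ≫ c₁ = j₁ ∧ IsOpenImmersion j₁' :=
    ⟨j₁.isoOpensRange.hom ≫ inv (c₁ ∣_ j₁.opensRange) ≫ (c₁ ⁻¹ᵁ j₁.opensRange).ι, by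
      rw [Category.assoc, Category.assoc, ← morphismRestrict_ι, IsIso.inv_hom_id_assoc,
        Scheme.Hom.isoOpensRange_hom_ι], inferInstance⟩
  obtain ⟨j₂', hj₂'c, hj₂'o⟩ : ∃ j₂' : ↑(f ⁻¹ᵁ W) ⟶ Y₂', j₂' ≫ c₂ = j₂ ∧ IsOpenImmersion j₂' :=
    ⟨j₂.isoOpensRange.hom ≫ inv (c₂ ∣_ j₂.opensRange) ≫ (c₂ ⁻¹ᵁ j₂.opensRange).ι, by
      rw [Category.assoc, Category.assoc, ← morphismRestrict_ι, IsIso.inv_hom_id_assoc,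
        Scheme.Hom.isoOpensRange_hom_ι], inferInstance⟩
  haveI := hj₁'o
  haveI := hj₂'o
  -- `cᵢ` restricted over `πᵢ⁻¹B` is the blowing up in `Kᵢ`, hence isomorphic to `T`
  have hc₁B : IsBlowup (c₁ ∣_ (π₁ ⁻¹ᵁ B)) K₁ := hG₁K ▸ hc₁.restrict (π₁ ⁻¹ᵁ B)
  have hc₂B : IsBlowup (c₂ ∣_ (π₂ ⁻¹ᵁ B)) K₂ := hG₂K ▸ hc₂.restrict (π₂ ⁻¹ᵁ B)
  obtain ⟨φ₁, hφ₁, -⟩ := hK₁.unique hc₁B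
  obtain ⟨φ₂, hφ₂, -⟩ := hK₂.unique hc₂B
  obtain ⟨u₁, hu₁c, hu₁o, hru₁⟩ : ∃ u₁ : T ⟶ Y₁', u₁ ≫ c₁ = t₁ ≫ (π₁ ⁻¹ᵁ B).ι ∧
      IsOpenImmersion u₁ ∧ Set.range u₁ = ((c₁ ⁻¹ᵁ (π₁ ⁻¹ᵁ B) : Y₁'.Opens) : Set Y₁') := by
    refine ⟨φ₁.hom ≫ (c₁ ⁻¹ᵁ (π₁ ⁻¹ᵁ B)).ι, ?_, inferInstance, ?_⟩
    · rw [Category.assoc, ← morphismRestrict_ι, reassoc_of% hφ₁]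
    · rw [← Scheme.Opens.range_ι (c₁ ⁻¹ᵁ (π₁ ⁻¹ᵁ B))]
      refine Set.Subset.antisymm (by rintro _ ⟨x, rfl⟩; exact ⟨_, (Scheme.Hom.comp_apply _ _ x).symm⟩)
        ?_
      rintro _ ⟨y, rfl⟩
      obtain ⟨x, rfl⟩ := (Scheme.homeoOfIso φ₁).surjective y
      exact ⟨x, Scheme.Hom.comp_apply _ _ x⟩
  obtain ⟨u₂, hu₂c, hu₂o, hru₂⟩ : ∃ u₂ : T ⟶ Y₂', u₂ ≫ c₂ = t₂ ≫ (π₂ ⁻¹ᵁ B).ι ∧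
      IsOpenImmersion u₂ ∧ Set.range u₂ = ((c₂ ⁻¹ᵁ (π₂ ⁻¹ᵁ B) : Y₂'.Opens) : Set Y₂') := by
    refine ⟨φ₂.hom ≫ (c₂ ⁻¹ᵁ (π₂ ⁻¹ᵁ B)).ι, ?_, inferInstance, ?_⟩
    · rw [Category.assoc, ← morphismRestrict_ι, reassoc_of% hφ₂]
    · rw [← Scheme.Opens.range_ι (c₂ ⁻¹ᵁ (π₂ ⁻¹ᵁ B))]
      refine Set.Subset.antisymm (by rintro _ ⟨x, rfl⟩; exact ⟨_, (Scheme.Hom.comp_apply _ _ x).symm⟩)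
        ?_
      rintro _ ⟨y, rfl⟩
      obtain ⟨x, rfl⟩ := (Scheme.homeoOfIso φ₂).surjective y
      exact ⟨x, Scheme.Hom.comp_apply _ _ x⟩
  haveI := hu₁o
  haveI := hu₂o
  -- the lifts of `jᵢ` restricted to `f⁻¹B` both come from `e : f⁻¹B → T`
  have hej₁ : X.homOfLE hle₁ ≫ j₁' = e ≫ u₁ := by
    have hcomp : (X.homOfLE hle₁ ≫ j₁') ≫ c₁ = (e ≫ u₁) ≫ c₁ := by
      rw [Category.assoc, hj₁'c, Category.assoc, hu₁c, reassoc_of% het₁, he₁ι]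
    refine eq_of_comp_eq_of_isIso_morphismRestrict c₁ j₁.opensRange hcomp fun x => ?_
    rw [← Scheme.Hom.comp_apply, Category.assoc, hj₁'c, Scheme.Hom.comp_apply]
    exact ⟨_, rfl⟩
  have hej₂ : X.homOfLE hle₂ ≫ j₂' = e ≫ u₂ := by
    have hcomp : (X.homOfLE hle₂ ≫ j₂') ≫ c₂ = (e ≫ u₂) ≫ c₂ := by
      rw [Category.assoc, hj₂'c, Category.assoc, hu₂c, reassoc_of% het₂, he₂ι]
    refine eq_of_comp_eq_of_isIso_morphismRestrict c₂ j₂.opensRange hcomp fun x => ?_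
    rw [← Scheme.Hom.comp_apply, Category.assoc, hj₂'c, Scheme.Hom.comp_apply]
    exact ⟨_, rfl⟩
  /- Step 4: glue `Y₁'` and `Y₂'` along `T` -/
  have hu : u₁ ≫ c₁ ≫ π₁ = u₂ ≫ c₂ ≫ π₂ := by
    rw [reassoc_of% hu₁c, reassoc_of% hu₂c, ← morphismRestrict_ι, ← morphismRestrict_ι,
      reassoc_of% ht]
  haveI := isOpenImmersion_inl u₁ u₂
  haveI := isOpenImmersion_inr u₁ u₂
  obtain ⟨ρ, hlρ, hrρ⟩ : ∃ ρ : pushout u₁ u₂ ⟶ S, pushout.inl u₁ u₂ ≫ ρ = c₁ ≫ π₁ ∧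
      pushout.inr u₁ u₂ ≫ ρ = c₂ ≫ π₂ :=
    ⟨pushout.desc _ _ hu, pushout.inl_desc _ _ _, pushout.inr_desc _ _ _⟩
  have hcov := range_inl_union_range_inr u₁ u₂
  -- `ρ⁻¹(V) = Y₁'` and `ρ⁻¹(W) = Y₂'`
  have hρV : ρ ⁻¹ᵁ V = (pushout.inl u₁ u₂).opensRange := by
    ext z
    constructor
    · intro hz
      replace hz : ρ z ∈ V := hz
      rcases Set.eq_univ_iff_forall.mp hcov z with ⟨y, rfl⟩ | ⟨y, rfl⟩
      · exact ⟨y, rfl⟩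
      · rw [← Scheme.Hom.comp_apply, hrρ, Scheme.Hom.comp_apply] at hz
        have hy : y ∈ ((c₂ ⁻¹ᵁ (π₂ ⁻¹ᵁ B) : Y₂'.Opens) : Set Y₂') := by
          show π₂ (c₂ y) ∈ B
          rw [hB]
          exact ⟨hz, hπ₂W _⟩
        rw [← hru₂] at hy
        obtain ⟨x, rfl⟩ := hy
        exact ⟨u₁ x, by rw [← Scheme.Hom.comp_apply, pushout.condition, Scheme.Hom.comp_apply]⟩
    · rintro ⟨y, rfl⟩
      show ρ (pushout.inl u₁ u₂ y) ∈ V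
      rw [← Scheme.Hom.comp_apply, hlρ, Scheme.Hom.comp_apply]
      exact hπ₁V _
  have hρW : ρ ⁻¹ᵁ W = (pushout.inr u₁ u₂).opensRange := by
    ext z
    constructor
    · intro hz
      replace hz : ρ z ∈ W := hz
      rcases Set.eq_univ_iff_forall.mp hcov z with ⟨y, rfl⟩ | ⟨y, rfl⟩
      · rw [← Scheme.Hom.comp_apply, hlρ, Scheme.Hom.comp_apply] at hz
        have hy : y ∈ ((c₁ ⁻¹ᵁ (π₁ ⁻¹ᵁ B) : Y₁'.Opens) : Set Y₁') := by
          show π₁ (c₁ y) ∈ B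
          rw [hB]
          exact ⟨hπ₁V _, hz⟩
        rw [← hru₁] at hy
        obtain ⟨x, rfl⟩ := hy
        exact ⟨u₂ x, by rw [← Scheme.Hom.comp_apply, ← pushout.condition, Scheme.Hom.comp_apply]⟩
      · exact ⟨y, rfl⟩
    · rintro ⟨y, rfl⟩
      show ρ (pushout.inr u₁ u₂ y) ∈ W
      rw [← Scheme.Hom.comp_apply, hrρ, Scheme.Hom.comp_apply]
      exact hπ₂W _
  -- `ρ` is proper: Zariski-locally over `V` and `W` it is `cᵢ ≫ qᵢ`
  have hpbV : IsPullback (c₁ ≫ q₁) (pushout.inl u₁ u₂) V.ι ρ :=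
    IsOpenImmersion.isPullback _ _ _ _ (by rw [hlρ, hπ₁, Category.assoc])
      (by rw [Scheme.Opens.opensRange_ι, hρV])
  have hpbW : IsPullback (c₂ ≫ q₂) (pushout.inr u₁ u₂) W.ι ρ :=
    IsOpenImmersion.isPullback _ _ _ _ (by rw [hrρ, hπ₂, Category.assoc])
      (by rw [Scheme.Opens.opensRange_ι, hρW])
  haveI : IsProper ρ := by
    apply IsZariskiLocalAtTarget.of_iSup_eq_top (P := @IsProper) (fun b : Bool => cond b V W)
      (by rw [iSup_bool_eq]; exact hVW)
    rintro (_ | _)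
    · change IsProper (ρ ∣_ W)
      rw [← (isPullback_morphismRestrict ρ W).isoIsPullback_hom_fst _ _ hpbW]
      infer_instance
    · change IsProper (ρ ∣_ V)
      rw [← (isPullback_morphismRestrict ρ V).isoIsPullback_hom_fst _ _ hpbV]
      infer_instance
  /- Step 5: the open immersion `X → Y₁' ⨿_T Y₂'`, glued from `j₁'` and `j₂'` -/
  have hXcov : (f ⁻¹ᵁ V) ⊔ (f ⁻¹ᵁ W) = ⊤ := by
    apply Opens.ext
    rw [Opens.coe_sup, Opens.coe_top, Set.eq_univ_iff_forall]
    intro x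
    have hx : f x ∈ (V ⊔ W : S.Opens) := by rw [hVW]; trivial
    exact hx
  let 𝒰 : X.OpenCover := X.openCoverOfIsOpenCover (fun b : Bool => cond b (f ⁻¹ᵁ V) (f ⁻¹ᵁ W))
    (TopologicalSpace.IsOpenCover.mk (by rw [iSup_bool_eq]; exact hXcov))
  let g : ∀ b : Bool, 𝒰.X b ⟶ pushout u₁ u₂ := fun b =>
    match b with
    | true => j₁' ≫ pushout.inl u₁ u₂
    | false => j₂' ≫ pushout.inr u₁ u₂
  -- compatibility on the overlap `f⁻¹B`: both maps factor through `e : f⁻¹B → T`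
  have hcompat : ∀ {P : Scheme.{u}} (a : P ⟶ ↑(f ⁻¹ᵁ V)) (b : P ⟶ ↑(f ⁻¹ᵁ W)),
      a ≫ (f ⁻¹ᵁ V).ι = b ≫ (f ⁻¹ᵁ W).ι →
      a ≫ j₁' ≫ pushout.inl u₁ u₂ = b ≫ j₂' ≫ pushout.inr u₁ u₂ := by
    intro P a b hab
    have hrange : Set.range (a ≫ (f ⁻¹ᵁ V).ι) ⊆ Set.range (f ⁻¹ᵁ B).ι := by
      rw [Scheme.Opens.range_ι]
      rintro _ ⟨p, rfl⟩
      show f ((a ≫ (f ⁻¹ᵁ V).ι) p) ∈ B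
      rw [hB]
      refine ⟨?_, ?_⟩
      · rw [Scheme.Hom.comp_apply, Scheme.Opens.ι_apply]
        exact (a p).2
      · rw [hab, Scheme.Hom.comp_apply, Scheme.Opens.ι_apply]
        exact (b p).2
    set d := IsOpenImmersion.lift (f ⁻¹ᵁ B).ι _ hrange with hd
    have hdι : d ≫ (f ⁻¹ᵁ B).ι = a ≫ (f ⁻¹ᵁ V).ι := IsOpenImmersion.lift_fac _ _ _
    have ha : a = d ≫ X.homOfLE hle₁ := by
      rw [← cancel_mono (f ⁻¹ᵁ V).ι, Category.assoc, Scheme.homOfLE_ι, hdι]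
    have hb : b = d ≫ X.homOfLE hle₂ := by
      rw [← cancel_mono (f ⁻¹ᵁ W).ι, Category.assoc, Scheme.homOfLE_ι, hdι, hab]
    rw [ha, hb, Category.assoc, Category.assoc, reassoc_of% hej₁, reassoc_of% hej₂,
      pushout.condition]
  have hg : ∀ x y : Bool, pullback.fst (𝒰.f x) (𝒰.f y) ≫ g x = pullback.snd _ _ ≫ g y := by
    rintro (_ | _) (_ | _)
    · change pullback.fst (f ⁻¹ᵁ W).ι (f ⁻¹ᵁ W).ι ≫ j₂' ≫ pushout.inr u₁ u₂ =
        pullback.snd (f ⁻¹ᵁ W).ι (f ⁻¹ᵁ W).ι ≫ j₂' ≫ pushout.inr u₁ u₂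
      rw [fst_eq_snd_of_mono_eq]
    · change pullback.fst (f ⁻¹ᵁ W).ι (f ⁻¹ᵁ V).ι ≫ j₂' ≫ pushout.inr u₁ u₂ =
        pullback.snd (f ⁻¹ᵁ W).ι (f ⁻¹ᵁ V).ι ≫ j₁' ≫ pushout.inl u₁ u₂
      exact (hcompat _ _ pullback.condition.symm).symm
    · change pullback.fst (f ⁻¹ᵁ V).ι (f ⁻¹ᵁ W).ι ≫ j₁' ≫ pushout.inl u₁ u₂ =
        pullback.snd (f ⁻¹ᵁ V).ι (f ⁻¹ᵁ W).ι ≫ j₂' ≫ pushout.inr u₁ u₂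
      exact hcompat _ _ pullback.condition
    · change pullback.fst (f ⁻¹ᵁ V).ι (f ⁻¹ᵁ V).ι ≫ j₁' ≫ pushout.inl u₁ u₂ =
        pullback.snd (f ⁻¹ᵁ V).ι (f ⁻¹ᵁ V).ι ≫ j₁' ≫ pushout.inl u₁ u₂
      rw [fst_eq_snd_of_mono_eq]
  set j : X ⟶ pushout u₁ u₂ := 𝒰.glueMorphisms g hg with hjdef
  have hjV : (f ⁻¹ᵁ V).ι ≫ j = j₁' ≫ pushout.inl u₁ u₂ := 𝒰.ι_glueMorphisms g hg true
  have hjW : (f ⁻¹ᵁ W).ι ≫ j = j₂' ≫ pushout.inr u₁ u₂ := 𝒰.ι_glueMorphisms g hg false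
  -- `j ≫ ρ = f`
  have hjρ : j ≫ ρ = f := by
    refine Scheme.Cover.hom_ext 𝒰 _ _ ?_
    rintro (_ | _)
    · change (f ⁻¹ᵁ W).ι ≫ j ≫ ρ = (f ⁻¹ᵁ W).ι ≫ f
      rw [reassoc_of% hjW, hrρ, reassoc_of% hj₂'c, hjπ₂]
    · change (f ⁻¹ᵁ V).ι ≫ j ≫ ρ = (f ⁻¹ᵁ V).ι ≫ f
      rw [reassoc_of% hjV, hlρ, reassoc_of% hj₁'c, hjπ₁]
  -- `j` is an open immersion: Zariski-locally over `ρ⁻¹V = Y₁'` and `ρ⁻¹W = Y₂'`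
  have hOV : j ⁻¹ᵁ (ρ ⁻¹ᵁ V) = f ⁻¹ᵁ V := by
    show (j ≫ ρ) ⁻¹ᵁ V = f ⁻¹ᵁ V
    rw [hjρ]
  have hOW : j ⁻¹ᵁ (ρ ⁻¹ᵁ W) = f ⁻¹ᵁ W := by
    show (j ≫ ρ) ⁻¹ᵁ W = f ⁻¹ᵁ W
    rw [hjρ]
  haveI : IsOpenImmersion j := by
    apply IsZariskiLocalAtTarget.of_iSup_eq_top (P := @IsOpenImmersion)
      (fun b : Bool => cond b (ρ ⁻¹ᵁ V) (ρ ⁻¹ᵁ W))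
      (by
        rw [iSup_bool_eq]
        show ρ ⁻¹ᵁ (V ⊔ W) = ⊤
        rw [hVW]
        rfl)
    rintro (_ | _)
    · change IsOpenImmersion (j ∣_ (ρ ⁻¹ᵁ W))
      have h1 : (j ⁻¹ᵁ (ρ ⁻¹ᵁ W)).ι ≫ j = (X.isoOfEq hOW).hom ≫ j₂' ≫ pushout.inr u₁ u₂ := by
        rw [← hjW, Scheme.isoOfEq_hom_ι_assoc]
      haveI : IsOpenImmersion ((j ∣_ (ρ ⁻¹ᵁ W)) ≫ (ρ ⁻¹ᵁ W).ι) := by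
        rw [morphismRestrict_ι, h1]
        infer_instance
      exact IsOpenImmersion.of_comp _ (ρ ⁻¹ᵁ W).ι
    · change IsOpenImmersion (j ∣_ (ρ ⁻¹ᵁ V))
      have h1 : (j ⁻¹ᵁ (ρ ⁻¹ᵁ V)).ι ≫ j = (X.isoOfEq hOV).hom ≫ j₁' ≫ pushout.inl u₁ u₂ := by
        rw [← hjV, Scheme.isoOfEq_hom_ι_assoc]
      haveI : IsOpenImmersion ((j ∣_ (ρ ⁻¹ᵁ V)) ≫ (ρ ⁻¹ᵁ V).ι) := by
        rw [morphismRestrict_ι, h1]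
        infer_instance
      exact IsOpenImmersion.of_comp _ (ρ ⁻¹ᵁ V).ι
  exact ⟨pushout u₁ u₂, j, ρ, inferInstance, inferInstance, hjρ⟩


/-- **Compactifiability over a quasi-compact quasi-separated base follows from compactifiability
over its affine opens** (induction over a finite affine open cover, gluing one affine open at a
time by `exists_compactification_of_sup_eq_top`). Unconditional form of
`exists_compactification_of_forall_affineOpens`.
[cite: Conrad2007, Remark 2.12 and §4; StacksProject, Tag 0F41] -/
theorem exists_compactification_of_affineOpens {X S : Scheme.{u}}
    [CompactSpace S] [QuasiSeparatedSpace S] (f : X ⟶ S) [QuasiCompact f]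
    (h : ∀ U : S.affineOpens, ∃ (Y : Scheme.{u}) (j : ↑(f ⁻¹ᵁ (U : S.Opens)) ⟶ Y)
      (q : Y ⟶ (U : S.Opens)), IsOpenImmersion j ∧ IsProper q ∧ j ≫ q = f ∣_ (U : S.Opens)) :
    ∃ (Y : Scheme.{u}) (j : X ⟶ Y) (q : Y ⟶ S), IsOpenImmersion j ∧ IsProper q ∧ j ≫ q = f := by
  classical
  obtain ⟨t, ht⟩ := exists_finset_affineOpens_iSup_eq_top S
  -- induction over the finite affine cover: compactifications of `f` over `⋃_{U ∈ t'} U`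
  have key : ∀ t' : Finset S.affineOpens,
      IsCompact (((⨆ U ∈ t', (U : S.Opens) : S.Opens)) : Set S) ∧
      ∃ (Y : Scheme.{u}) (j : ↑(f ⁻¹ᵁ (⨆ U ∈ t', (U : S.Opens))) ⟶ Y)
        (q : Y ⟶ ↑(⨆ U ∈ t', (U : S.Opens))),
        IsOpenImmersion j ∧ IsProper q ∧ j ≫ q = f ∣_ (⨆ U ∈ t', (U : S.Opens)) := by
    intro t'
    induction t' using Finset.induction_on with
    | empty =>
      have h0 : (⨆ U ∈ (∅ : Finset S.affineOpens), (U : S.Opens)) = ⊥ := by simp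
      haveI : IsEmpty ↑(f ⁻¹ᵁ (⨆ U ∈ (∅ : Finset S.affineOpens), (U : S.Opens))) :=
        ⟨fun x => by
          obtain ⟨y, hy⟩ := x
          have hy' : f y ∈ ((⨆ U ∈ (∅ : Finset S.affineOpens), (U : S.Opens)) : S.Opens) := hy
          have hbot : f y ∈ (⊥ : S.Opens) := h0 ▸ hy'
          exact hbot⟩
      refine ⟨by rw [h0]; exact isCompact_empty, _, 𝟙 _, f ∣_ _, inferInstance, inferInstance,
        Category.id_comp _⟩
    | insert A t' hA ih =>
      obtain ⟨hOc, hO⟩ := ih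
      -- the new open `O' = A ∪ O`
      have hO' : (⨆ U ∈ insert A t', (U : S.Opens)) = (A : S.Opens) ⊔ ⨆ U ∈ t', (U : S.Opens) :=
        Finset.iSup_insert A t' _
      set O : S.Opens := ⨆ U ∈ t', (U : S.Opens) with hOdef
      set O' : S.Opens := ⨆ U ∈ insert A t', (U : S.Opens) with hO'def
      have hO'c : IsCompact (O' : Set S) := by
        rw [hO', Opens.coe_sup]
        exact A.2.isCompact.union hOc
      refine ⟨hO'c, ?_⟩
      haveI : CompactSpace O' := isCompact_iff_compactSpace.mp hO'c
      haveI : QuasiSeparatedSpace O' :=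
        QuasiSeparatedSpace.of_isOpenEmbedding O'.ι.isOpenEmbedding
      have hAO' : (A : S.Opens) ≤ O' := hO' ▸ le_sup_left
      have hOO' : O ≤ O' := hO' ▸ le_sup_right
      -- glue over `O' = O'↓O ∪ O'↓A`
      have hcov : (O'.ι ⁻¹ᵁ O) ⊔ (O'.ι ⁻¹ᵁ (A : S.Opens)) = ⊤ := by
        apply Opens.ext
        rw [Opens.coe_sup, Opens.coe_top, Set.eq_univ_iff_forall]
        intro x
        have hx : x.1 ∈ ((A : S.Opens) ⊔ O : S.Opens) := hO' ▸ x.2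
        rcases hx with hx | hx
        · exact Or.inr hx
        · exact Or.inl hx
      have hglue := exists_compactification_of_sup_eq_top (f ∣_ O') (O'.ι ⁻¹ᵁ O)
        (O'.ι ⁻¹ᵁ (A : S.Opens)) (O'.ι.isCompact_preimage hOc)
        (O'.ι.isCompact_preimage A.2.isCompact) hcov
      -- identify `(f|_{O'})|_{O'↓U}` with `f|_U` for `U = O, A`
      have htrans : ∀ (U : S.Opens) (hU : U ≤ O'),
          (∃ (Y : Scheme.{u}) (j : ↑(f ⁻¹ᵁ U) ⟶ Y) (q : Y ⟶ U),
            IsOpenImmersion j ∧ IsProper q ∧ j ≫ q = f ∣_ U) →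
          ∃ (Y : Scheme.{u}) (j : ↑((f ∣_ O') ⁻¹ᵁ (O'.ι ⁻¹ᵁ U)) ⟶ Y) (q : Y ⟶ ↑(O'.ι ⁻¹ᵁ U)),
            IsOpenImmersion j ∧ IsProper q ∧ j ≫ q = (f ∣_ O') ∣_ (O'.ι ⁻¹ᵁ U) := by
        intro U hU hU'
        have hUU' : O'.ι ''ᵁ (O'.ι ⁻¹ᵁ U) = U := by
          rw [Scheme.Hom.image_preimage_eq_opensRange_inf, Scheme.Opens.opensRange_ι,
            inf_eq_right]
          exact hU
        exact exists_compactification_of_arrow_iso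
          (morphismRestrictRestrict f O' (O'.ι ⁻¹ᵁ U) ≪≫ morphismRestrictEq f hUU').symm hU'
      obtain ⟨Y, j, q, hj, hq, hjq⟩ := hglue (htrans O hOO' hO) (htrans A hAO' (h A))
      exact ⟨Y, j, q, hj, hq, hjq⟩
  -- the whole of `S`
  obtain ⟨-, Y, j, q, hj, hq, hjq⟩ := key t
  have htop : (⨆ U ∈ t, (U : S.Opens)) = ⊤ := top_le_iff.mp ht
  haveI := hj
  haveI := hq
  have hXtop : f ⁻¹ᵁ (⨆ U ∈ t, (U : S.Opens)) = ⊤ := by rw [htop]; rfl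
  haveI : IsProper ((S.isoOfEq htop).hom ≫ S.topIso.hom) := MorphismProperty.of_isIso @IsProper _
  refine ⟨Y, (X.topIso.inv ≫ (X.isoOfEq hXtop).inv) ≫ j, q ≫ (S.isoOfEq htop).hom ≫ S.topIso.hom,
    inferInstance, inferInstance, ?_⟩
  rw [Scheme.topIso_hom, Category.assoc, Category.assoc, reassoc_of% hjq, Scheme.isoOfEq_hom_ι,
    morphismRestrict_ι, Scheme.isoOfEq_inv_ι_assoc, ← Scheme.topIso_hom, Iso.inv_hom_id_assoc]


/-! ### Nagata's compactification theorem -/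

/-- **Nagata's compactification theorem (Conrad 2007, Thm. 4.1 = The Stacks Project, Tag 0F41):
the named fact `NagataCompactification` holds.** Every separated morphism of finite type
`f : X → S` to a quasi-compact quasi-separated scheme factors as an open immersion followed by a
proper morphism. Proof: that of `NagataCompactification.of_stacks081R` with the unconditional
`exists_compactification_of_affineOpens` and `stacks0F40` (see the module docstring).
[cite: Conrad2007, Thm. 4.1; StacksProject, Tag 0F41] -/
theorem NagataCompactification_holds : NagataCompactification := by
  intro X S f _ _ _ _ _
  refine exists_compactification_of_affineOpens f fun U => ?_
  haveI : IsAffine (U : S.Opens) := U.2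
  -- over the affine `U ≅ Spec Γ(U)`
  obtain ⟨Y, j, q, hj, hq, hjq⟩ := exists_compactification_affineBase_of_twoPiece_noetherian
    (fun S U _ g _ _ => exists_compactification_of_isAffine g)
    (by
      intro S X _ _ _ f _ _ W W₁ W₂ hW hd h₁ h₂
      exact stacks0F40 f W W₁ W₂ hW hd h₁ h₂)
    ((f ∣_ (U : S.Opens)) ≫ (Scheme.isoSpec (U : S.Opens)).hom)
  haveI := hq
  exact ⟨Y, j, q ≫ (Scheme.isoSpec (U : S.Opens)).inv, hj, inferInstance, by
    rw [reassoc_of% hjq, Iso.hom_inv_id, Category.comp_id]⟩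


end Literature.AlgebraicGeometry.Morphisms

end
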